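import Literature.MathematicalPhysics.QuantumManyBody.PeriodicBoseGasUpperBound
import Literature.MathematicalPhysics.QuantumManyBody.PeriodicBoseGasThm31
import HarnessLib

/-!
# LSSY Theorem 2.2, step 2: the product trial state (proof of `LSSY2005_jastrowBound`)

Topic `Literature/MathematicalPhysics/QuantumManyBody`, sibling of `PeriodicBoseGasUpperBound.lean`
(provefact `Literature.MathematicalPhysics.QuantumManyBody.BoseGas.LSSY2005_upperBound_periodic`). This file *proves* the named fact
`LSSY2005_jastrowBound` of `PeriodicBoseGasUpperBound.lean`: for a pair profile `φ` with cut-off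
`b`, `0 < 2b < L`, and bounds `E₁ ≤ E`, `I ≤ I'`, `K ≤ K'` with `(N-1)I' < L³`,
`E₀^per(N, L) ≤ N(N-1)/2 · E/(L³ - (N-1)I') + N(N-1)(N-2) K'²/(L³ - (N-1)I')²`,
by the variational principle with the symmetric product state `Ψ = ∏_{i<j} Φ(xᵢ - xⱼ)`,
`Φ(y) = φ(y - L n(y))` (`n(y)` the nearest lattice point), following the printed proof
[LSSY2005, Thm. 2.2, (2.19)–(2.31)] with Dyson's nearest-neighbour function replaced by the
product over all pairs (see the docstring of `LSSY2005_jastrowBound`).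

## Contents

* Lattice reduction `reduce L y = y - L n(y)` and the periodic, even, `C¹` pair factor
  `pairFactor L φ = φ ∘ reduce L` (for `2b < L` it is locally a translate of `φ`).
* Lattice sums `latSum` and the unfolding identity `∫_Ω h^per(x - z) dx = ∫_{ℝ³} h`
  (`lintegral_cell_latSum_sub`, from the tiling lemma of `PeriodicBoseGasLemma32.lean`); the
  potential bound `v^per Φ² ≤ (vφ²)^per` (`IsPairProfile.periodizedPotential_mul_le`).
* The product state `jastrow L φ S X = ∏_{i<j ∈ S} Φ(xᵢ - xⱼ)`, its square as a product over
  ordered pairs, splitting off a particle, and the **one-particle elimination**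
  `‖Ψ_{S∖a}‖² ≤ ‖Ψ_S‖² + |S∖a| L⁻³ I ‖Ψ_{S∖a}‖²` [(2.22)–(2.26)]
  (`IsPairProfile.jastrowNormSq_erase_le`).
* The slice in particle `k`, its gradient, and the **pointwise kinetic bound**
  `|∇ₖΨ|² ≤ ∑_{l≠k} |∇Φ|²(x_k-x_l) Ψ_{∖k}² + ∑_{i≠j≠k} (Φ|∇Φ|)(x_k-x_i)(Φ|∇Φ|)(x_k-x_j) Ψ_{∖{i,j}}²`
  [(2.19)–(2.21)] (`IsPairProfile.gradSqC_slice_le`); integrating out particles against the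
  kernels (`lintegral_cellN_kernel_mul_le`) gives the kinetic and potential energy bounds
  [(2.26)–(2.31)] (`IsPairProfile.lintegral_kinetic_le`, `IsPairProfile.lintegral_potential_le`).
* The normalised trial state (`IsPairProfile.trialState`: `C¹`, periodic, Bose-symmetric,
  normalised; positivity of the norm from the elimination bound), the counting of pair and
  three-body terms, and the proof `LSSY2005_jastrowBound_holds`.

## References

* [LSSY2005] E. H. Lieb, R. Seiringer, J. P. Solovej, J. Yngvason, *The Mathematics of the Bose
  Gas and its Condensation*, Oberwolfach Seminars 34, Birkhäuser 2005, arXiv:cond-mat/0610117: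
  Thm. 2.2 and its proof, (2.15)–(2.33), pp. 12–13.
* [Dyson1957] F. J. Dyson, *Ground-state energy of a hard-sphere gas*, Phys. Rev. 106 (1957),
  20–26.
* [Fournais2020] S. Fournais, *Length scales for BEC in the dilute Bose gas*, arXiv:2011.00309,
  (1.1) (the periodised potential as a lattice sum).
-/

noncomputable section

open MeasureTheory Filter Topology Set WithLp
open scoped ENNReal NNReal

namespace Literature.MathematicalPhysics.QuantumManyBody.BoseGas

/-! ### Lattice reduction to the nearest lattice point -/

section Lattice

variable {L : ℝ}

/-- The nearest lattice point `n(y) ∈ ℤ³` of `y/L` (coordinatewise rounding). [folklore] -/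
def nearestLat (L : ℝ) (y : Space) : Fin 3 → ℤ := fun k => round (y k / L)

/-- The reduced vector `y - L n(y)`, the representative of `y` modulo `Lℤ³` in the Voronoi cell
`[-L/2, L/2)³`. [folklore] -/
def reduce (L : ℝ) (y : Space) : Space := y - latticeVec L (nearestLat L y)

/-- Coordinates of the reduced vector: `(y - L n(y))_k = y_k - L·round(y_k/L)`. [folklore] -/
theorem reduce_apply (L : ℝ) (y : Space) (k : Fin 3) :
    reduce L y k = y k - L * round (y k / L) := by
  simp [reduce, nearestLat, latticeVec_apply]

/-- Each coordinate of the reduced vector is at most `L/2` in absolute value. [folklore] -/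
theorem abs_reduce_apply_le (hL : 0 < L) (y : Space) (k : Fin 3) : |reduce L y k| ≤ L / 2 := by
  rw [reduce_apply]
  have h : y k - L * round (y k / L) = L * (y k / L - round (y k / L)) := by
    field_simp
  rw [h, abs_mul, abs_of_pos hL]
  have := abs_sub_round (y k / L)
  nlinarith

/-- A coordinate is bounded by the Euclidean norm. [folklore] -/
theorem abs_apply_le_norm (y : Space) (k : Fin 3) : |y k| ≤ ‖y‖ := by
  simpa using PiLp.norm_apply_le y k

/-- If `y` is within `L/2` of the lattice point `Ln`, then `n` is the nearest lattice point.
[folklore] -/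
theorem nearestLat_eq_of_norm_lt (hL : 0 < L) {y : Space} {n : Fin 3 → ℤ}
    (h : ‖y - latticeVec L n‖ < L / 2) : nearestLat L y = n := by
  funext k
  have hk : |y k - L * n k| < L / 2 := by
    have h1 := abs_apply_le_norm (y - latticeVec L n) k
    simp only [PiLp.sub_apply, latticeVec_apply] at h1
    exact h1.trans_lt h
  rw [abs_lt] at hk
  simp only [nearestLat]
  rw [round_eq, Int.floor_eq_iff]
  have h1 : (n k : ℝ) - 1 / 2 < y k / L := by rw [lt_div_iff₀ hL]; linarith
  have h2 : y k / L < n k + 1 / 2 := by rw [div_lt_iff₀ hL]; linarith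
  constructor
  · linarith
  · linarith

/-- Hence `reduce L y = y - Ln` whenever `|y - Ln| < L/2`. [folklore] -/
theorem reduce_eq_of_norm_lt (hL : 0 < L) {y : Space} {n : Fin 3 → ℤ}
    (h : ‖y - latticeVec L n‖ < L / 2) : reduce L y = y - latticeVec L n := by
  rw [reduce, nearestLat_eq_of_norm_lt hL h]

/-- Lattice periodicity of the nearest lattice point. [folklore] -/
theorem nearestLat_add_latticeVec (hL : L ≠ 0) (y : Space) (m : Fin 3 → ℤ) :
    nearestLat L (y + latticeVec L m) = nearestLat L y + m := by
  funext k
  simp only [nearestLat, PiLp.add_apply, latticeVec_apply, Pi.add_apply]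
  rw [add_div, mul_div_cancel_left₀ _ hL, round_add_intCast]

/-- `reduce` is `Lℤ³`-periodic. [folklore] -/
theorem reduce_add_latticeVec (hL : L ≠ 0) (y : Space) (m : Fin 3 → ℤ) :
    reduce L (y + latticeVec L m) = reduce L y := by
  rw [reduce, reduce, nearestLat_add_latticeVec hL, latticeVec_add]
  abel

/-- The generator `L e_k` of `Lℤ³` is the lattice vector of `e_k ∈ ℤ³`. [folklore] -/
theorem single_eq_latticeVec (L : ℝ) (k : Fin 3) :
    EuclideanSpace.single k L = latticeVec L (Pi.single k 1) := by
  ext j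
  by_cases h : j = k
  · subst h; simp [latticeVec_apply]
  · simp [latticeVec_apply, h]

/-- If `y` reduces into the open ball of radius `b ≤ L/2`, then `-y` reduces to the opposite
vector. [folklore] -/
theorem reduce_neg_of_norm_lt (hL : 0 < L) {b : ℝ} (hb : 2 * b ≤ L) {y : Space}
    (h : ‖reduce L y‖ < b) : reduce L (-y) = -reduce L y := by
  have key : -y - latticeVec L (-nearestLat L y) = -reduce L y := by
    rw [latticeVec_neg, reduce]; abel
  have h' : ‖-y - latticeVec L (-nearestLat L y)‖ < L / 2 := by
    rw [key, norm_neg]; linarith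
  rw [reduce_eq_of_norm_lt hL h', key]

/-- Two points reducing into the ball of radius `b` around lattice points and within `L/2 - b`
of each other reduce by the same lattice point. [folklore] -/
theorem nearestLat_eq_of_norm_reduce_lt (hL : 0 < L) {b : ℝ} {y y₀ : Space}
    (hy : ‖reduce L y‖ < b) (hd : ‖y - y₀‖ < L / 2 - b) :
    nearestLat L y₀ = nearestLat L y := by
  refine nearestLat_eq_of_norm_lt hL ?_
  calc ‖y₀ - latticeVec L (nearestLat L y)‖
      = ‖(y - latticeVec L (nearestLat L y)) - (y - y₀)‖ := by congr 1; abel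
    _ ≤ ‖y - latticeVec L (nearestLat L y)‖ + ‖y - y₀‖ := norm_sub_le _ _
    _ < b + (L / 2 - b) := add_lt_add hy hd
    _ = L / 2 := by ring

end Lattice

/-! ### The periodic pair factor `Φ = φ ∘ reduce` -/

section PairFactor

variable {L b : ℝ} {φ : Space → ℝ}

/-- The `Lℤ³`-periodic two-body factor `Φ(y) = φ(y - L n(y))` of a pair profile `φ` (`φ` evaluated
at the nearest-image representative). [cite: LSSY2005, Thm. 2.2, proof, (2.16)–(2.18)] -/
def pairFactor (L : ℝ) (φ : Space → ℝ) (y : Space) : ℝ := φ (reduce L y)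

/-- Off the nearest image the profile is `1`: if `n ≠ n(y)` then `φ(y - Ln) = 1`. [folklore] -/
theorem IsPairProfile.apply_sub_latticeVec_of_ne (hφ : IsPairProfile b φ) (hL : 0 < L)
    (hbL : 2 * b ≤ L) {y : Space} {n : Fin 3 → ℤ} (hn : n ≠ nearestLat L y) :
    φ (y - latticeVec L n) = 1 := by
  by_contra h
  have hlt : ‖y - latticeVec L n‖ < b := by
    by_contra h'
    exact h (hφ.eq_one _ (not_lt.mp h'))
  exact hn (nearestLat_eq_of_norm_lt hL (by linarith)).symm

/-- **Local form.** Near `y₀`, `Φ(y) = φ(y - L n(y₀))`: on the ball of radius `L/2 - b` around `y₀`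
the pair factor is a translate of `φ`. [folklore] -/
theorem IsPairProfile.pairFactor_eq_near (hφ : IsPairProfile b φ) (hL : 0 < L) (hbL : 2 * b ≤ L)
    {y y₀ : Space} (hd : ‖y - y₀‖ < L / 2 - b) :
    pairFactor L φ y = φ (y - latticeVec L (nearestLat L y₀)) := by
  unfold pairFactor
  by_cases hy : ‖reduce L y‖ < b
  · rw [reduce, nearestLat_eq_of_norm_reduce_lt hL hy hd]
  · rw [hφ.eq_one _ (not_lt.mp hy)]
    by_cases hn : nearestLat L y₀ = nearestLat L y
    · rw [hn, ← reduce, hφ.eq_one _ (not_lt.mp hy)]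
    · exact (hφ.apply_sub_latticeVec_of_ne hL hbL hn).symm

/-- The pair factor is `C¹`. [folklore] -/
theorem IsPairProfile.contDiff_pairFactor (hφ : IsPairProfile b φ) (hL : 0 < L) (hbL : 2 * b < L) :
    ContDiff ℝ 1 (pairFactor L φ) := by
  rw [contDiff_iff_contDiffAt]
  intro y₀
  have hev : pairFactor L φ =ᶠ[𝓝 y₀] fun y => φ (y - latticeVec L (nearestLat L y₀)) := by
    filter_upwards [Metric.ball_mem_nhds y₀ (show 0 < L / 2 - b by linarith)] with y hy
    exact hφ.pairFactor_eq_near hL hbL.le (by rwa [← dist_eq_norm])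
  refine ContDiffAt.congr_of_eventuallyEq ?_ hev
  exact ((hφ.contDiff.comp (contDiff_id.sub contDiff_const)).contDiffAt)

/-- The gradient of the pair factor is the gradient of the profile at the reduced point.
[folklore] -/
theorem IsPairProfile.fderiv_pairFactor (hφ : IsPairProfile b φ) (hL : 0 < L) (hbL : 2 * b < L)
    (y : Space) : fderiv ℝ (pairFactor L φ) y = fderiv ℝ φ (reduce L y) := by
  have hev : pairFactor L φ =ᶠ[𝓝 y] fun y' => φ (y' - latticeVec L (nearestLat L y)) := by
    filter_upwards [Metric.ball_mem_nhds y (show 0 < L / 2 - b by linarith)] with y' hy'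
    exact hφ.pairFactor_eq_near hL hbL.le (by rwa [← dist_eq_norm])
  rw [hev.fderiv_eq, fderiv_comp_sub, reduce]

/-- `∇Φ(y) = ∇φ(y - L n(y))`: the gradient vector of the pair factor. [folklore] -/
theorem IsPairProfile.gradVec_pairFactor (hφ : IsPairProfile b φ) (hL : 0 < L) (hbL : 2 * b < L)
    (y : Space) : gradVec (pairFactor L φ) y = gradVec φ (reduce L y) := by
  simp only [gradVec, hφ.fderiv_pairFactor hL hbL]

/-- `0 ≤ Φ ≤ 1`. [folklore] -/
theorem IsPairProfile.pairFactor_nonneg (hφ : IsPairProfile b φ) (y : Space) :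
    0 ≤ pairFactor L φ y := hφ.nonneg _

/-- `Φ ≤ 1`. [folklore] -/
theorem IsPairProfile.pairFactor_le_one (hφ : IsPairProfile b φ) (y : Space) :
    pairFactor L φ y ≤ 1 := hφ.le_one _

/-- `Φ` is `Lℤ³`-periodic. [folklore] -/
theorem pairFactor_add_latticeVec (hL : L ≠ 0) (φ : Space → ℝ) (y : Space) (m : Fin 3 → ℤ) :
    pairFactor L φ (y + latticeVec L m) = pairFactor L φ y := by
  simp only [pairFactor, reduce_add_latticeVec hL]

/-- `Φ(y - Lm) = Φ(y)`: periodicity under subtraction of lattice vectors. [folklore] -/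
theorem pairFactor_sub_latticeVec (hL : L ≠ 0) (φ : Space → ℝ) (y : Space) (m : Fin 3 → ℤ) :
    pairFactor L φ (y - latticeVec L m) = pairFactor L φ y := by
  rw [sub_eq_add_neg, ← latticeVec_neg, pairFactor_add_latticeVec hL]

/-- `Φ` is even. [folklore] -/
theorem IsPairProfile.pairFactor_neg (hφ : IsPairProfile b φ) (hL : 0 < L) (hbL : 2 * b ≤ L)
    (y : Space) : pairFactor L φ (-y) = pairFactor L φ y := by
  unfold pairFactor
  by_cases hy : ‖reduce L y‖ < b
  · rw [reduce_neg_of_norm_lt hL hbL hy, hφ.even]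
  · by_cases hy' : ‖reduce L (-y)‖ < b
    · have := reduce_neg_of_norm_lt hL hbL hy'
      rw [neg_neg] at this
      rw [this, hφ.even]
    · rw [hφ.eq_one _ (not_lt.mp hy), hφ.eq_one _ (not_lt.mp hy')]

/-- The derivative of an even differentiable function is odd. [folklore] -/
theorem fderiv_neg_apply_of_even {ψ : Space → ℝ} (hψ : Differentiable ℝ ψ)
    (heven : ∀ x, ψ (-x) = ψ x) (x v : Space) : fderiv ℝ ψ (-x) v = -fderiv ℝ ψ x v := by
  have hneg : HasFDerivAt (fun y : Space => -y) (-ContinuousLinearMap.id ℝ Space) (-x) :=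
    (hasFDerivAt_id (-x)).neg
  have hcomp := ((hψ (-(-x))).hasFDerivAt).comp (-x) hneg
  have heq : (ψ ∘ fun y : Space => -y) = ψ := funext fun y => heven y
  rw [heq] at hcomp
  rw [hcomp.fderiv]
  simp

/-- The gradient of an even `C¹` function is odd. [folklore] -/
theorem gradVec_neg_of_even {ψ : Space → ℝ} (hψ : Differentiable ℝ ψ)
    (heven : ∀ x, ψ (-x) = ψ x) (x : Space) : gradVec ψ (-x) = -gradVec ψ x := by
  ext k
  simp only [gradVec, PiLp.neg_apply, PiLp.toLp_apply]
  exact fderiv_neg_apply_of_even hψ heven x _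

/-- The gradient of a pair profile is odd: `∇φ(-x) = -∇φ(x)`. [folklore] -/
theorem IsPairProfile.gradVec_neg (hφ : IsPairProfile b φ) (x : Space) :
    gradVec φ (-x) = -gradVec φ x :=
  gradVec_neg_of_even (hφ.contDiff.differentiable one_ne_zero) hφ.even x

/-- `|∇Φ|` is even. [folklore] -/
theorem IsPairProfile.norm_gradVec_pairFactor_neg (hφ : IsPairProfile b φ) (hL : 0 < L)
    (hbL : 2 * b < L) (y : Space) :
    ‖gradVec (pairFactor L φ) (-y)‖ = ‖gradVec (pairFactor L φ) y‖ := by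
  rw [gradVec_neg_of_even ((hφ.contDiff_pairFactor hL hbL).differentiable one_ne_zero)
    (hφ.pairFactor_neg hL hbL.le), norm_neg]

end PairFactor

/-! ### Lattice sums and their cell integrals -/

section LatSum

variable {L : ℝ}

/-- The lattice sum `h^per(y) = ∑_{n ∈ ℤ³} h(y - Ln) ∈ [0, ∞]` of a non-negative function
(`periodizedPotential v L = (v ∘ |·|)^per`). [cite: Fournais2020, (1.1)] -/
def latSum (L : ℝ) (h : Space → ℝ≥0∞) (y : Space) : ℝ≥0∞ :=
  ∑' n : Fin 3 → ℤ, h (y - latticeVec L n)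

/-- The periodised potential is the lattice sum of `v ∘ |·|`. [cite: Fournais2020, (1.1)] -/
theorem periodizedPotential_eq_latSum (v : ℝ → ℝ≥0∞) (L : ℝ) :
    periodizedPotential v L = latSum L fun z => v ‖z‖ := rfl

/-- Each lattice translate is bounded by the lattice sum. [folklore] -/
theorem apply_sub_latticeVec_le_latSum (h : Space → ℝ≥0∞) (y : Space) (n : Fin 3 → ℤ) :
    h (y - latticeVec L n) ≤ latSum L h y :=
  ENNReal.le_tsum n

/-- In particular the value at the reduced point is bounded by the lattice sum. [folklore] -/
theorem apply_reduce_le_latSum (h : Space → ℝ≥0∞) (y : Space) :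
    h (reduce L y) ≤ latSum L h y :=
  apply_sub_latticeVec_le_latSum h y _

/-- Lattice sums of measurable functions are measurable. [folklore] -/
theorem measurable_latSum {h : Space → ℝ≥0∞} (hh : Measurable h) : Measurable (latSum L h) := by
  unfold latSum
  exact Measurable.tsum fun n => hh.comp (measurable_id.sub_const (latticeVec L n))

/-- **Unfolding the torus.** `∫_{[0,L)³} h^per(x - z) dx = ∫_{ℝ³} h` for every `z`: the translates
of the cell tile `ℝ³`. [folklore] -/
theorem lintegral_cell_latSum_sub (hL : 0 < L) {h : Space → ℝ≥0∞} (hh : Measurable h)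
    (z : Space) : ∫⁻ x in cell L, latSum L h (x - z) = ∫⁻ x, h x := by
  unfold latSum
  rw [lintegral_tsum (f := fun (n : Fin 3 → ℤ) (x : Space) => h (x - z - latticeVec L n))
    fun n => (hh.comp ((measurable_id.sub_const z).sub_const (latticeVec L n))).aemeasurable]
  have h1 : ∀ n : Fin 3 → ℤ, (fun x : Space => h (x - z - latticeVec L n)) =
      fun x => (fun u => h (u - z)) (x - latticeVec L n) := by
    intro n; funext x; simp only [sub_right_comm]
  simp_rw [h1]
  rw [tsum_lintegral_cell_sub_latticeVec hL fun u => h (u - z), lintegral_sub_right_eq_self]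

/-- The same with the argument reversed, for even `h`. [folklore] -/
theorem lintegral_cell_latSum_sub' (hL : 0 < L) {h : Space → ℝ≥0∞} (hh : Measurable h)
    (heven : ∀ x, h (-x) = h x) (z : Space) :
    ∫⁻ x in cell L, latSum L h (z - x) = ∫⁻ x, h x := by
  have : ∀ x, latSum L h (z - x) = latSum L (fun u => h (-u)) (x - z) := by
    intro x
    unfold latSum
    rw [← (Equiv.neg (Fin 3 → ℤ)).tsum_eq]
    refine tsum_congr fun n => ?_
    simp only [Equiv.neg_apply, latticeVec_neg]
    congr 1; abel
  simp_rw [this, heven]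
  exact lintegral_cell_latSum_sub hL hh z

end LatSum

/-! ### The potential term: `v^per Φ² ≤ (v φ²)^per` -/

section Potential

variable {L b : ℝ} {φ : Space → ℝ}

/-- `v^per(y) Φ(y)² ≤ ∑ₙ v(|y - Ln|) φ(y - Ln)²`: on the nearest image the two sides agree, and
off it `φ(y - Ln) = 1 ≥ Φ(y)²`. [cite: LSSY2005, Thm. 2.2, proof, (2.26)–(2.27)] -/
theorem IsPairProfile.periodizedPotential_mul_le (hφ : IsPairProfile b φ) (hL : 0 < L)
    (hbL : 2 * b ≤ L) (v : ℝ → ℝ≥0∞) (y : Space) :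
    periodizedPotential v L y * ENNReal.ofReal (pairFactor L φ y ^ 2) ≤
      latSum L (fun z => v ‖z‖ * ENNReal.ofReal (φ z ^ 2)) y := by
  rw [periodizedPotential_eq_latSum, latSum, latSum, ← ENNReal.tsum_mul_right]
  refine ENNReal.tsum_le_tsum fun n => ?_
  by_cases hn : n = nearestLat L y
  · rw [hn, ← reduce, pairFactor]
  · rw [hφ.apply_sub_latticeVec_of_ne hL hbL hn]
    refine mul_le_mul' le_rfl ?_
    rw [one_pow, ENNReal.ofReal_one, ENNReal.ofReal_le_one]
    have h0 := hφ.pairFactor_nonneg (L := L) y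
    have h1 := hφ.pairFactor_le_one (L := L) y
    nlinarith

end Potential

/-! ### Products over pairs -/

section PairProducts

open Finset

variable {α M : Type*} [LinearOrder α] [CommMonoid M]

/-- The ordered pairs `i < j` of a finite set. [folklore] -/
def pairsOf (S : Finset α) : Finset (α × α) := (S ×ˢ S).filter fun p => p.1 < p.2

omit [CommMonoid M] in
/-- Membership in the set of ordered pairs `i < j` of `S`. [folklore] -/
theorem mem_pairsOf {S : Finset α} {p : α × α} :
    p ∈ pairsOf S ↔ p.1 ∈ S ∧ p.2 ∈ S ∧ p.1 < p.2 := by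
  simp [pairsOf, and_assoc]

omit [CommMonoid M] in
/-- `pairsOf` is monotone in the set. [folklore] -/
theorem pairsOf_mono {S T : Finset α} (h : S ⊆ T) : pairsOf S ⊆ pairsOf T := by
  intro p hp
  rw [mem_pairsOf] at hp ⊢
  exact ⟨h hp.1, h hp.2.1, hp.2.2⟩

/-- A product over pairs is an iterated product. [folklore] -/
theorem prod_pairsOf_eq (S : Finset α) (w : α → α → M) :
    ∏ p ∈ pairsOf S, w p.1 p.2 = ∏ i ∈ S, ∏ j ∈ S.filter (i < ·), w i j := by
  rw [pairsOf, prod_filter, prod_product]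
  refine prod_congr rfl fun i _ => ?_
  simp only [prod_filter]

/-- Reversing the order of an iterated product over pairs (for a symmetric weight).
[folklore] -/
theorem prod_pairs_comm (S : Finset α) (w : α → α → M) (hw : ∀ i j, w i j = w j i) :
    ∏ i ∈ S, ∏ j ∈ S.filter (i < ·), w i j = ∏ i ∈ S, ∏ j ∈ S.filter (· < i), w i j := by
  rw [prod_comm' (t' := S) (s' := fun j => S.filter (· < j))]
  · exact prod_congr rfl fun j _ => prod_congr rfl fun i _ => hw i j
  · intro i j
    simp only [mem_filter]
    tauto

/-- The square of a product over pairs is the product over ordered off-diagonal pairs.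
[folklore] -/
theorem prod_pairs_sq (S : Finset α) (w : α → α → M) (hw : ∀ i j, w i j = w j i) :
    (∏ i ∈ S, ∏ j ∈ S.filter (i < ·), w i j) ^ 2 = ∏ i ∈ S, ∏ j ∈ S.erase i, w i j := by
  classical
  rw [sq]
  conv_lhs => rw [prod_pairs_comm S w hw]; arg 1; rw [← prod_pairs_comm S w hw]
  rw [← prod_mul_distrib]
  refine prod_congr rfl fun i hi => ?_
  have h1 : S.filter (i < ·) = (S.erase i).filter (i < ·) := by
    ext j
    simp only [mem_filter, mem_erase]
    constructor
    · rintro ⟨hj, hij⟩; exact ⟨⟨hij.ne', hj⟩, hij⟩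
    · rintro ⟨⟨_, hj⟩, hij⟩; exact ⟨hj, hij⟩
  have h2 : S.filter (· < i) = (S.erase i).filter (fun j => ¬ i < j) := by
    ext j
    simp only [mem_filter, mem_erase]
    constructor
    · rintro ⟨hj, hji⟩; exact ⟨⟨hji.ne, hj⟩, not_lt.mpr hji.le⟩
    · rintro ⟨⟨hne, hj⟩, hn⟩; exact ⟨hj, lt_of_le_of_ne (not_lt.mp hn) hne⟩
  rw [h1, h2, prod_filter_mul_prod_filter_not]

/-- Splitting off one point from the product over off-diagonal pairs. [folklore] -/
theorem prod_offDiag_split (S : Finset α) {a : α} (ha : a ∈ S) (w : α → α → M)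
    (hw : ∀ i j, w i j = w j i) :
    ∏ i ∈ S, ∏ j ∈ S.erase i, w i j =
      (∏ j ∈ S.erase a, w a j) ^ 2 * ∏ i ∈ S.erase a, ∏ j ∈ (S.erase a).erase i, w i j := by
  classical
  rw [← mul_prod_erase S _ ha, sq, mul_assoc]
  congr 1
  rw [← prod_mul_distrib]
  refine prod_congr rfl fun i hi => ?_
  have hai : a ∈ S.erase i := mem_erase.mpr ⟨(ne_of_mem_erase hi).symm, ha⟩
  rw [← mul_prod_erase (S.erase i) _ hai, hw i a, erase_right_comm]

end PairProducts

/-! ### The Jastrow product state -/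

section Jastrow

open Finset

variable {N : ℕ} {L b : ℝ} {φ : Space → ℝ}

/-- The Jastrow product `Ψ_S(X) = ∏_{i<j, i,j ∈ S} Φ(xᵢ - xⱼ)` over the pairs of a set `S` of
particles (`S = univ`: the trial state; smaller `S`: the states with particles eliminated).
[cite: LSSY2005, Thm. 2.2, proof, (2.15)–(2.16); Dyson1957] -/
def jastrow (L : ℝ) (φ : Space → ℝ) (S : Finset (Fin N)) (X : Config N) : ℝ :=
  ∏ p ∈ pairsOf S, pairFactor L φ (X p.1 - X p.2)

/-- The product over pairs as an iterated product `∏ᵢ ∏_{j > i}`. [folklore] -/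
theorem jastrow_eq_prod_prod (S : Finset (Fin N)) (X : Config N) :
    jastrow L φ S X = ∏ i ∈ S, ∏ j ∈ S.filter (i < ·), pairFactor L φ (X i - X j) :=
  prod_pairsOf_eq S fun i j => pairFactor L φ (X i - X j)

/-- `Φ(x - y) = Φ(y - x)` (the pair factor is even). [folklore] -/
theorem IsPairProfile.pairFactor_sub_comm (hφ : IsPairProfile b φ) (hL : 0 < L) (hbL : 2 * b ≤ L)
    (x y : Space) : pairFactor L φ (x - y) = pairFactor L φ (y - x) := by
  rw [← neg_sub, hφ.pairFactor_neg hL hbL]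

/-- `Ψ_S² = ∏_{i ∈ S} ∏_{j ∈ S, j ≠ i} Φ(xᵢ - xⱼ)`. [folklore] -/
theorem IsPairProfile.jastrow_sq (hφ : IsPairProfile b φ) (hL : 0 < L) (hbL : 2 * b ≤ L)
    (S : Finset (Fin N)) (X : Config N) :
    jastrow L φ S X ^ 2 = ∏ i ∈ S, ∏ j ∈ S.erase i, pairFactor L φ (X i - X j) := by
  rw [jastrow_eq_prod_prod]
  exact prod_pairs_sq S _ fun i j => hφ.pairFactor_sub_comm hL hbL (X i) (X j)

/-- **Splitting off a particle**: `Ψ_S² = (∏_{j ∈ S∖a} Φ(x_a - xⱼ))² Ψ_{S∖a}²`.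
[cite: LSSY2005, Thm. 2.2, proof, (2.22)–(2.23)] -/
theorem IsPairProfile.jastrow_sq_split (hφ : IsPairProfile b φ) (hL : 0 < L) (hbL : 2 * b ≤ L)
    (S : Finset (Fin N)) {a : Fin N} (ha : a ∈ S) (X : Config N) :
    jastrow L φ S X ^ 2 =
      (∏ j ∈ S.erase a, pairFactor L φ (X a - X j)) ^ 2 * jastrow L φ (S.erase a) X ^ 2 := by
  rw [hφ.jastrow_sq hL hbL, hφ.jastrow_sq hL hbL,
    prod_offDiag_split S ha _ fun i j => hφ.pairFactor_sub_comm hL hbL (X i) (X j)]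

/-- `Ψ_S ≥ 0`. [folklore] -/
theorem IsPairProfile.jastrow_nonneg (hφ : IsPairProfile b φ) (S : Finset (Fin N)) (X : Config N) :
    0 ≤ jastrow L φ S X :=
  prod_nonneg fun _ _ => hφ.pairFactor_nonneg _

/-- `Ψ_S ≤ 1`. [folklore] -/
theorem IsPairProfile.jastrow_le_one (hφ : IsPairProfile b φ) (S : Finset (Fin N)) (X : Config N) :
    jastrow L φ S X ≤ 1 :=
  prod_le_one (fun _ _ => hφ.pairFactor_nonneg _) fun _ _ => hφ.pairFactor_le_one _

/-- Dropping factors: the product over the pairs of a subset is larger. [folklore] -/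
theorem IsPairProfile.prod_le_jastrow (hφ : IsPairProfile b φ) {P : Finset (Fin N × Fin N)}
    {S : Finset (Fin N)} (h : pairsOf S ⊆ P) (X : Config N) :
    ∏ p ∈ P, pairFactor L φ (X p.1 - X p.2) ≤ jastrow L φ S X := by
  classical
  rw [jastrow, ← prod_sdiff h]
  refine mul_le_of_le_one_left (prod_nonneg fun p _ => hφ.pairFactor_nonneg _) ?_
  exact prod_le_one (fun p _ => hφ.pairFactor_nonneg _) fun p _ => hφ.pairFactor_le_one _

/-- `Ψ_S` does not depend on the particles outside `S`. [folklore] -/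
theorem jastrow_update_of_notMem {S : Finset (Fin N)} {i : Fin N} (hi : i ∉ S) (X : Config N)
    (x : Space) : jastrow L φ S (Function.update X i x) = jastrow L φ S X := by
  refine prod_congr rfl fun p hp => ?_
  rw [mem_pairsOf] at hp
  rw [Function.update_of_ne (ne_of_mem_of_not_mem hp.1 hi),
    Function.update_of_ne (ne_of_mem_of_not_mem hp.2.1 hi)]

/-- `Ψ_S` is continuous. [folklore] -/
theorem IsPairProfile.continuous_jastrow (hφ : IsPairProfile b φ) (hL : 0 < L) (hbL : 2 * b < L)
    (S : Finset (Fin N)) : Continuous (jastrow L φ S) := by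
  refine continuous_finsetProd _ fun p _ => ?_
  exact (hφ.contDiff_pairFactor hL hbL).continuous.comp (by fun_prop)

/-- `Ψ_S` is `C¹`. [folklore] -/
theorem IsPairProfile.contDiff_jastrow (hφ : IsPairProfile b φ) (hL : 0 < L) (hbL : 2 * b < L)
    (S : Finset (Fin N)) : ContDiff ℝ 1 (jastrow L φ S) := by
  refine contDiff_prod fun p _ => ?_
  exact (hφ.contDiff_pairFactor hL hbL).comp
    ((contDiff_apply ℝ Space p.1).sub (contDiff_apply ℝ Space p.2))

/-- **One-particle elimination, pointwise** [(2.24)–(2.25)]: with `gⱼ = 1 - Φ(x_a - xⱼ)² ∈ [0,1]`,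
`Ψ_{S∖a}² ≤ Ψ_S² + Ψ_{S∖a}² ∑_{j ∈ S∖a} gⱼ`, from `1 ≤ ∏(1 - gⱼ) + ∑ gⱼ`.
[cite: LSSY2005, Thm. 2.2, proof, (2.24)–(2.25)] -/
theorem one_le_prod_add_sum {ι : Type*} (s : Finset ι) (t : ι → ℝ) (h0 : ∀ j ∈ s, 0 ≤ t j)
    (h1 : ∀ j ∈ s, t j ≤ 1) : 1 ≤ ∏ j ∈ s, t j + ∑ j ∈ s, (1 - t j) := by
  classical
  induction s using Finset.induction_on with
  | empty => simp
  | insert a s has ih =>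
    rw [prod_insert has, sum_insert has]
    have ha0 := h0 a (mem_insert_self a s)
    have ha1 := h1 a (mem_insert_self a s)
    have ih' := ih (fun j hj => h0 j (mem_insert_of_mem hj)) (fun j hj => h1 j (mem_insert_of_mem hj))
    have hP : ∏ j ∈ s, t j ≤ 1 :=
      prod_le_one (fun j hj => h0 j (mem_insert_of_mem hj)) fun j hj => h1 j (mem_insert_of_mem hj)
    have hP0 : 0 ≤ ∏ j ∈ s, t j := prod_nonneg fun j hj => h0 j (mem_insert_of_mem hj)
    nlinarith

/-- **One-particle elimination, pointwise**: `Ψ_{S∖a}² ≤ Ψ_S² + Ψ_{S∖a}² ∑_{j ∈ S∖a} (1 - Φ(x_a - x_j)²)`. [cite: LSSY2005, Thm. 2.2, proof, (2.24)–(2.25)] -/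
theorem IsPairProfile.jastrow_sq_erase_le (hφ : IsPairProfile b φ) (hL : 0 < L) (hbL : 2 * b ≤ L)
    (S : Finset (Fin N)) {a : Fin N} (ha : a ∈ S) (X : Config N) :
    jastrow L φ (S.erase a) X ^ 2 ≤ jastrow L φ S X ^ 2 +
      jastrow L φ (S.erase a) X ^ 2 * ∑ j ∈ S.erase a, (1 - pairFactor L φ (X a - X j) ^ 2) := by
  rw [hφ.jastrow_sq_split hL hbL S ha, ← Finset.prod_pow]
  have h := one_le_prod_add_sum (S.erase a) (fun j => pairFactor L φ (X a - X j) ^ 2)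
    (fun j _ => sq_nonneg _) (fun j _ => by
      have h0 := hφ.pairFactor_nonneg (L := L) (X a - X j)
      have h1 := hφ.pairFactor_le_one (L := L) (X a - X j)
      nlinarith)
  have hJ : 0 ≤ jastrow L φ (S.erase a) X ^ 2 := sq_nonneg _
  nlinarith [mul_le_mul_of_nonneg_left h hJ]

end Jastrow

/-! ### Gradients: `gradSq = |gradVec|²`, continuity -/

section Gradients

variable {L b : ℝ} {φ : Space → ℝ}

/-- `|∇ψ|² = ‖gradVec ψ‖²` (as an extended real). [folklore] -/
theorem ofReal_norm_gradVec_sq (ψ : Space → ℝ) (x : Space) :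
    ENNReal.ofReal (‖gradVec ψ x‖ ^ 2) = gradSq ψ x := by
  rw [gradVec, EuclideanSpace.real_norm_sq_eq, ENNReal.ofReal_sum_of_nonneg fun k _ => sq_nonneg _]
  refine Finset.sum_congr rfl fun k _ => ?_
  rw [PiLp.toLp_apply, ← Real.enorm_eq_ofReal (sq_nonneg _)]
  rw [Real.enorm_eq_ofReal_abs, abs_pow, pow_two, ENNReal.ofReal_mul (abs_nonneg _), ← pow_two,
    ← Real.norm_eq_abs, ofReal_norm, enorm_eq_nnnorm]

/-- For a `C¹` function the gradient vector is continuous. [folklore] -/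
theorem continuous_gradVec {ψ : Space → ℝ} (hψ : ContDiff ℝ 1 ψ) : Continuous (gradVec ψ) := by
  unfold gradVec
  refine (PiLp.continuous_toLp 2 _).comp ?_
  refine continuous_pi fun k => ?_
  exact (hψ.continuous_fderiv one_ne_zero).clm_apply continuous_const

/-- `|∇ψ|²` is measurable for a `C¹` function. [folklore] -/
theorem measurable_gradSq {ψ : Space → ℝ} (hψ : ContDiff ℝ 1 ψ) : Measurable (gradSq ψ) := by
  have : gradSq ψ = fun x => ENNReal.ofReal (‖gradVec ψ x‖ ^ 2) :=
    funext fun x => (ofReal_norm_gradVec_sq ψ x).symm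
  rw [this]
  exact ((continuous_gradVec hψ).norm.pow 2).measurable.ennreal_ofReal

/-- `|∇Φ|²(y) = |∇φ|²(reduce y)`. [folklore] -/
theorem IsPairProfile.gradSq_pairFactor (hφ : IsPairProfile b φ) (hL : 0 < L) (hbL : 2 * b < L)
    (y : Space) : gradSq (pairFactor L φ) y = gradSq φ (reduce L y) := by
  rw [← ofReal_norm_gradVec_sq, ← ofReal_norm_gradVec_sq, hφ.gradVec_pairFactor hL hbL]

end Gradients

/-! ### Cell integrals of the three two-body kernels -/

section Kernels

variable {L b : ℝ} {φ : Space → ℝ}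

/-- `∫_Ω (1 - Φ(x - z)²) dx ≤ I`. [cite: LSSY2005, Thm. 2.2, proof, (2.25), (2.29)] -/
theorem IsPairProfile.lintegral_cell_defect_le (hφ : IsPairProfile b φ) (hL : 0 < L) (z : Space) :
    ∫⁻ x in cell L, ENNReal.ofReal (1 - pairFactor L φ (x - z) ^ 2) ≤ profileDefect φ := by
  have hm : Measurable fun u : Space => ENNReal.ofReal (1 - φ u ^ 2) :=
    (continuous_const.sub (hφ.contDiff.continuous.pow 2)).measurable.ennreal_ofReal
  calc ∫⁻ x in cell L, ENNReal.ofReal (1 - pairFactor L φ (x - z) ^ 2)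
      ≤ ∫⁻ x in cell L, latSum L (fun u => ENNReal.ofReal (1 - φ u ^ 2)) (x - z) :=
        lintegral_mono fun x => apply_reduce_le_latSum (fun u => ENNReal.ofReal (1 - φ u ^ 2)) _
    _ = profileDefect φ := lintegral_cell_latSum_sub hL hm z

/-- `∫_Ω |∇Φ|²(x - z) dx ≤ ∫ |∇φ|²`. [cite: LSSY2005, Thm. 2.2, proof, (2.27)] -/
theorem IsPairProfile.lintegral_cell_gradSq_le (hφ : IsPairProfile b φ) (hL : 0 < L)
    (hbL : 2 * b < L) (z : Space) :
    ∫⁻ x in cell L, gradSq (pairFactor L φ) (x - z) ≤ ∫⁻ x, gradSq φ x := by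
  calc ∫⁻ x in cell L, gradSq (pairFactor L φ) (x - z)
      ≤ ∫⁻ x in cell L, latSum L (gradSq φ) (x - z) := lintegral_mono fun x => by
        rw [hφ.gradSq_pairFactor hL hbL]
        exact apply_reduce_le_latSum (gradSq φ) _
    _ = ∫⁻ x, gradSq φ x := lintegral_cell_latSum_sub hL (measurable_gradSq hφ.contDiff) z

/-- `∫_Ω (v φ²)^per(x - z) dx = ∫ v φ²`. [cite: LSSY2005, Thm. 2.2, proof, (2.27)] -/
theorem IsPairProfile.lintegral_cell_potential_eq (hφ : IsPairProfile b φ) (hL : 0 < L)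
    {v : ℝ → ℝ≥0∞} (hv : Measurable v) (z : Space) :
    ∫⁻ x in cell L, latSum L (fun u => v ‖u‖ * ENNReal.ofReal (φ u ^ 2)) (x - z) =
      ∫⁻ x, v ‖x‖ * ENNReal.ofReal (φ x ^ 2) :=
  lintegral_cell_latSum_sub hL ((hv.comp measurable_norm).mul
    (hφ.contDiff.continuous.pow 2).measurable.ennreal_ofReal) z

/-- `∫_Ω (Φ|∇Φ|)(z - x) dx ≤ K`. [cite: LSSY2005, Thm. 2.2, proof, (2.31)] -/
theorem IsPairProfile.lintegral_cell_K_le (hφ : IsPairProfile b φ) (hL : 0 < L) (hbL : 2 * b < L)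
    (z : Space) :
    ∫⁻ x in cell L, ENNReal.ofReal (pairFactor L φ (z - x) * ‖gradVec (pairFactor L φ) (z - x)‖) ≤
      profileK φ := by
  have hm : Measurable fun u : Space => ENNReal.ofReal (φ u * ‖gradVec φ u‖) :=
    (hφ.contDiff.continuous.mul (continuous_gradVec hφ.contDiff).norm).measurable.ennreal_ofReal
  calc ∫⁻ x in cell L, ENNReal.ofReal (pairFactor L φ (z - x) * ‖gradVec (pairFactor L φ) (z - x)‖)
      = ∫⁻ x in cell L, ENNReal.ofReal
          (pairFactor L φ (x - z) * ‖gradVec (pairFactor L φ) (x - z)‖) := by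
        refine lintegral_congr fun x => ?_
        rw [← neg_sub x z, hφ.pairFactor_neg hL hbL.le, hφ.norm_gradVec_pairFactor_neg hL hbL]
    _ ≤ ∫⁻ x in cell L, latSum L (fun u => ENNReal.ofReal (φ u * ‖gradVec φ u‖)) (x - z) :=
        lintegral_mono fun x => by
          rw [pairFactor, hφ.gradVec_pairFactor hL hbL]
          exact apply_reduce_le_latSum (fun u => ENNReal.ofReal (φ u * ‖gradVec φ u‖)) _
    _ = profileK φ := lintegral_cell_latSum_sub hL hm z

end Kernels

/-! ### Norms of the Jastrow states and the integrated elimination -/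

section Elimination

open Finset

variable {N : ℕ} {L b : ℝ} {φ : Space → ℝ}

/-- `‖Ψ_S‖² = ∫_{Ω^N} Ψ_S²` (over all `N` variables; `Ψ_S` is constant in those outside `S`).
[cite: LSSY2005, Thm. 2.2, proof, (2.22)] -/
def jastrowNormSq (L : ℝ) (φ : Space → ℝ) (S : Finset (Fin N)) : ℝ≥0∞ :=
  ∫⁻ X in cellN N L, ENNReal.ofReal (jastrow L φ S X ^ 2)

/-- `Ψ_S²` is measurable (as an `ℝ≥0∞`-valued function). [folklore] -/
theorem IsPairProfile.measurable_jastrow_sq (hφ : IsPairProfile b φ) (hL : 0 < L) (hbL : 2 * b < L)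
    (S : Finset (Fin N)) : Measurable fun X => ENNReal.ofReal (jastrow L φ S X ^ 2) :=
  ((hφ.continuous_jastrow hL hbL S).pow 2).measurable.ennreal_ofReal

/-- `‖Ψ_S‖² ≤ |Ω|^N < ∞`. [folklore] -/
theorem IsPairProfile.jastrowNormSq_le (hφ : IsPairProfile b φ) (S : Finset (Fin N)) :
    jastrowNormSq L φ S ≤ (ENNReal.ofReal L ^ 3) ^ N := by
  calc jastrowNormSq L φ S ≤ ∫⁻ _ in cellN N L, 1 := lintegral_mono fun X => by
        rw [ENNReal.ofReal_le_one]
        have h0 := hφ.jastrow_nonneg (L := L) S X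
        have h1 := hφ.jastrow_le_one (L := L) S X
        nlinarith
    _ = (ENNReal.ofReal L ^ 3) ^ N := by rw [lintegral_const, one_mul, Measure.restrict_apply_univ,
        volume_cellN]

/-- `‖Ψ_S‖² < ∞`. [folklore] -/
theorem IsPairProfile.jastrowNormSq_ne_top (hφ : IsPairProfile b φ) (S : Finset (Fin N)) :
    jastrowNormSq L φ S ≠ ⊤ :=
  ne_top_of_le_ne_top (ENNReal.pow_ne_top (ENNReal.pow_ne_top ENNReal.ofReal_ne_top))
    (hφ.jastrowNormSq_le S)

/-- The defect integral of one eliminated pair: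
`∫_{Ω^N} Ψ_T² (1 - Φ(x_a - x_j)²) ≤ L⁻³ I ‖Ψ_T‖²` for `a ∉ T`, `j ≠ a`.
[cite: LSSY2005, Thm. 2.2, proof, (2.25)] -/
theorem IsPairProfile.lintegral_jastrow_sq_mul_defect_le (hφ : IsPairProfile b φ) (hL : 0 < L)
    (hbL : 2 * b < L) {T : Finset (Fin N)} {a j : Fin N} (ha : a ∉ T) (hja : j ≠ a) :
    ∫⁻ X in cellN N L, ENNReal.ofReal (jastrow L φ T X ^ 2) *
        ENNReal.ofReal (1 - pairFactor L φ (X a - X j) ^ 2) ≤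
      (ENNReal.ofReal L ^ 3)⁻¹ * profileDefect φ * jastrowNormSq L φ T := by
  have hL3 : ENNReal.ofReal L ^ 3 ≠ 0 := pow_ne_zero _ (by simpa using hL)
  have hL3' : ENNReal.ofReal L ^ 3 ≠ ⊤ := ENNReal.pow_ne_top ENNReal.ofReal_ne_top
  set H : Config N → ℝ≥0∞ := fun X => ENNReal.ofReal (jastrow L φ T X ^ 2) *
    ENNReal.ofReal (1 - pairFactor L φ (X a - X j) ^ 2) with hH
  have hHm : Measurable H := by
    refine (hφ.measurable_jastrow_sq hL hbL T).mul ?_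
    exact (continuous_const.sub (((hφ.contDiff_pairFactor hL hbL).continuous.comp
      (by fun_prop)).pow 2)).measurable.ennreal_ofReal
  have key := lintegral_cellN_lintegral_update (L := L) a hHm
  -- the slice integral
  have hslice : ∀ X : Config N, ∫⁻ x in cell L, H (Function.update X a x) ≤
      ENNReal.ofReal (jastrow L φ T X ^ 2) * profileDefect φ := by
    intro X
    have h1 : ∀ x, H (Function.update X a x) = ENNReal.ofReal (jastrow L φ T X ^ 2) *
        ENNReal.ofReal (1 - pairFactor L φ (x - X j) ^ 2) := by
      intro x
      simp only [hH, jastrow_update_of_notMem ha, Function.update_self,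
        Function.update_of_ne hja]
    simp_rw [h1]
    rw [lintegral_const_mul' _ _ ENNReal.ofReal_ne_top]
    exact mul_le_mul' le_rfl (hφ.lintegral_cell_defect_le hL (X j))
  calc ∫⁻ X in cellN N L, H X
      = (ENNReal.ofReal L ^ 3)⁻¹ * (ENNReal.ofReal L ^ 3 * ∫⁻ X in cellN N L, H X) := by
        rw [← mul_assoc, ENNReal.inv_mul_cancel hL3 hL3', one_mul]
    _ = (ENNReal.ofReal L ^ 3)⁻¹ * ∫⁻ X in cellN N L, ∫⁻ x in cell L, H (Function.update X a x) := by
        rw [key]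
    _ ≤ (ENNReal.ofReal L ^ 3)⁻¹ *
          ∫⁻ X in cellN N L, ENNReal.ofReal (jastrow L φ T X ^ 2) * profileDefect φ := by
        exact mul_le_mul' le_rfl (lintegral_mono hslice)
    _ = (ENNReal.ofReal L ^ 3)⁻¹ * profileDefect φ * jastrowNormSq L φ T := by
        rw [lintegral_mul_const _ (hφ.measurable_jastrow_sq hL hbL T), jastrowNormSq]
        ring

/-- **One-particle elimination** [(2.22)–(2.26)]: for `a ∈ S` and `T = S ∖ {a}`,
`‖Ψ_T‖² ≤ ‖Ψ_S‖² + |T| L⁻³ I ‖Ψ_T‖²`. [cite: LSSY2005, Thm. 2.2, proof, (2.22)–(2.26)] -/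
theorem IsPairProfile.jastrowNormSq_erase_le (hφ : IsPairProfile b φ) (hL : 0 < L)
    (hbL : 2 * b < L) (S : Finset (Fin N)) {a : Fin N} (ha : a ∈ S) :
    jastrowNormSq L φ (S.erase a) ≤ jastrowNormSq L φ S +
      (S.erase a).card * ((ENNReal.ofReal L ^ 3)⁻¹ * profileDefect φ *
        jastrowNormSq L φ (S.erase a)) := by
  set T := S.erase a with hT
  have haT : a ∉ T := notMem_erase a S
  calc jastrowNormSq L φ T
      ≤ ∫⁻ X in cellN N L, (ENNReal.ofReal (jastrow L φ S X ^ 2) +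
          ∑ j ∈ T, ENNReal.ofReal (jastrow L φ T X ^ 2) *
            ENNReal.ofReal (1 - pairFactor L φ (X a - X j) ^ 2)) := by
        refine lintegral_mono fun X => ?_
        have h := hφ.jastrow_sq_erase_le hL hbL.le S ha X
        have hg : ∀ j, 0 ≤ 1 - pairFactor L φ (X a - X j) ^ 2 := fun j => by
          have h0 := hφ.pairFactor_nonneg (L := L) (X a - X j)
          have h1 := hφ.pairFactor_le_one (L := L) (X a - X j)
          nlinarith
        calc ENNReal.ofReal (jastrow L φ T X ^ 2)
            ≤ ENNReal.ofReal (jastrow L φ S X ^ 2 +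
                jastrow L φ T X ^ 2 * ∑ j ∈ T, (1 - pairFactor L φ (X a - X j) ^ 2)) :=
              ENNReal.ofReal_le_ofReal h
          _ = _ := by
              rw [ENNReal.ofReal_add (sq_nonneg _) (mul_nonneg (sq_nonneg _)
                (sum_nonneg fun j _ => hg j)), mul_sum,
                ENNReal.ofReal_sum_of_nonneg fun j _ => mul_nonneg (sq_nonneg _) (hg j)]
              congr 1
              exact sum_congr rfl fun j _ => ENNReal.ofReal_mul (sq_nonneg _)
    _ = jastrowNormSq L φ S + ∑ j ∈ T, ∫⁻ X in cellN N L, ENNReal.ofReal (jastrow L φ T X ^ 2) *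
            ENNReal.ofReal (1 - pairFactor L φ (X a - X j) ^ 2) := by
        rw [lintegral_add_left (hφ.measurable_jastrow_sq hL hbL S), jastrowNormSq,
          lintegral_finsetSum]
        intro j _
        refine (hφ.measurable_jastrow_sq hL hbL T).mul ?_
        exact (continuous_const.sub (((hφ.contDiff_pairFactor hL hbL).continuous.comp
          (by fun_prop)).pow 2)).measurable.ennreal_ofReal
    _ ≤ jastrowNormSq L φ S + ∑ j ∈ T, (ENNReal.ofReal L ^ 3)⁻¹ * profileDefect φ *
          jastrowNormSq L φ T := by
        gcongr with j hj
        exact hφ.lintegral_jastrow_sq_mul_defect_le hL hbL haT (ne_of_mem_erase hj)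
    _ = _ := by rw [sum_const, nsmul_eq_mul]

end Elimination

/-! ### The slice of the product state in one particle and its gradient -/

section Slice

open Finset

variable {N : ℕ} {L b : ℝ} {φ : Space → ℝ}

/-- `Π_k(X; x) = ∏_{l ≠ k} Φ(x - x_l)`: the dependence of `Ψ` on the `k`-th particle, the others
frozen at `X`. [cite: LSSY2005, Thm. 2.2, proof, (2.19)] -/
def sliceProd (L : ℝ) (φ : Space → ℝ) (k : Fin N) (X : Config N) (x : Space) : ℝ :=
  ∏ l ∈ univ.erase k, pairFactor L φ (x - X l)

/-- The cofactor `π_{k,l}(X; x) = ∏_{l' ≠ k, l} Φ(x - x_{l'}) ∈ [0, 1]` of the pair `{k, l}` in the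
slice. [cite: LSSY2005, Thm. 2.2, proof, (2.19)–(2.20)] -/
def sliceCof (L : ℝ) (φ : Space → ℝ) (k l : Fin N) (X : Config N) (x : Space) : ℝ :=
  ∏ l' ∈ (univ.erase k).erase l, pairFactor L φ (x - X l')

/-- `Π_k ≥ 0`. [folklore] -/
theorem IsPairProfile.sliceProd_nonneg (hφ : IsPairProfile b φ) (k : Fin N) (X : Config N)
    (x : Space) : 0 ≤ sliceProd L φ k X x :=
  prod_nonneg fun _ _ => hφ.pairFactor_nonneg _

/-- `Π_k ≤ 1`. [folklore] -/
theorem IsPairProfile.sliceProd_le_one (hφ : IsPairProfile b φ) (k : Fin N) (X : Config N)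
    (x : Space) : sliceProd L φ k X x ≤ 1 :=
  prod_le_one (fun _ _ => hφ.pairFactor_nonneg _) fun _ _ => hφ.pairFactor_le_one _

/-- `π_{k,l} ≥ 0`. [folklore] -/
theorem IsPairProfile.sliceCof_nonneg (hφ : IsPairProfile b φ) (k l : Fin N) (X : Config N)
    (x : Space) : 0 ≤ sliceCof L φ k l X x :=
  prod_nonneg fun _ _ => hφ.pairFactor_nonneg _

/-- `π_{k,l} ≤ 1`. [folklore] -/
theorem IsPairProfile.sliceCof_le_one (hφ : IsPairProfile b φ) (k l : Fin N) (X : Config N)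
    (x : Space) : sliceCof L φ k l X x ≤ 1 :=
  prod_le_one (fun _ _ => hφ.pairFactor_nonneg _) fun _ _ => hφ.pairFactor_le_one _

/-- Extracting one more factor from the cofactor: `π_{k,i} = Φ(x - x_j) · ∏_{l ≠ k,i,j}` for
`j ≠ i`, whence `π_{k,i} ≤ Φ(x - x_j) · ∏_{l ≠ k,i,j} Φ(x - x_l)`. [folklore] -/
theorem sliceCof_eq_mul {k i j : Fin N} (hjk : j ≠ k) (hji : j ≠ i) (X : Config N) (x : Space) :
    sliceCof L φ k i X x =
      pairFactor L φ (x - X j) * ∏ l ∈ ((univ.erase k).erase i).erase j, pairFactor L φ (x - X l) := by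
  have hj : j ∈ (univ.erase k).erase i := mem_erase.mpr ⟨hji, mem_erase.mpr ⟨hjk, mem_univ j⟩⟩
  rw [sliceCof, ← mul_prod_erase _ _ hj]

/-- **Slice factorisation**: `Ψ(…, x_k := x, …) = Π_k(X; x) · Ψ_{∖k}(X)`.
[cite: LSSY2005, Thm. 2.2, proof, (2.19), (2.22)] -/
theorem IsPairProfile.jastrow_update (hφ : IsPairProfile b φ) (hL : 0 < L) (hbL : 2 * b ≤ L)
    (k : Fin N) (X : Config N) (x : Space) :
    jastrow L φ univ (Function.update X k x) =
      sliceProd L φ k X x * jastrow L φ (univ.erase k) X := by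
  have h := hφ.jastrow_sq_split hL hbL univ (mem_univ k) (Function.update X k x)
  rw [jastrow_update_of_notMem (notMem_erase k univ)] at h
  have h1 : ∏ j ∈ univ.erase k,
      pairFactor L φ (Function.update X k x k - Function.update X k x j) = sliceProd L φ k X x := by
    refine prod_congr rfl fun j hj => ?_
    rw [Function.update_self, Function.update_of_ne (ne_of_mem_erase hj)]
  rw [h1, ← mul_pow] at h
  exact (sq_eq_sq₀ (hφ.jastrow_nonneg _ _)
    (mul_nonneg (hφ.sliceProd_nonneg k X x) (hφ.jastrow_nonneg _ _))).mp h

/-- The gradient of the slice product: `∇Π_k = ∑_{l ≠ k} π_{k,l} ∇Φ(x - x_l)`.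
[cite: LSSY2005, Thm. 2.2, proof, (2.19)] -/
theorem IsPairProfile.hasFDerivAt_sliceProd (hφ : IsPairProfile b φ) (hL : 0 < L)
    (hbL : 2 * b < L) (k : Fin N) (X : Config N) (x : Space) :
    HasFDerivAt (sliceProd L φ k X)
      (∑ l ∈ univ.erase k, sliceCof L φ k l X x • fderiv ℝ (pairFactor L φ) (x - X l)) x := by
  have hd : ∀ l ∈ univ.erase k, HasFDerivAt (fun y => pairFactor L φ (y - X l))
      (fderiv ℝ (pairFactor L φ) (x - X l)) x := by
    intro l _
    have h1 := ((hφ.contDiff_pairFactor hL hbL).differentiable one_ne_zero (x - X l)).hasFDerivAt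
    have h2 := h1.comp x (hasFDerivAt_sub_const (X l))
    rw [ContinuousLinearMap.comp_id] at h2
    exact h2
  exact HasFDerivAt.finsetProd hd

/-- `∇Π_k(X; x) = ∑_{l ≠ k} π_{k,l}(X; x) ∇Φ(x - x_l)` as vectors. [cite: LSSY2005, Thm. 2.2, proof, (2.19)] -/
theorem IsPairProfile.gradVec_sliceProd (hφ : IsPairProfile b φ) (hL : 0 < L) (hbL : 2 * b < L)
    (k : Fin N) (X : Config N) (x : Space) :
    gradVec (sliceProd L φ k X) x =
      ∑ l ∈ univ.erase k, sliceCof L φ k l X x • gradVec (pairFactor L φ) (x - X l) := by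
  have h := (hφ.hasFDerivAt_sliceProd hL hbL k X x).fderiv
  ext m
  simp [gradVec, h, WithLp.ofLp_sum, Finset.sum_apply]

/-- `|∇Π_k(X; x)| ≤ ∑_{l ≠ k} π_{k,l}(X; x) |∇Φ(x - x_l)|`. [cite: LSSY2005, Thm. 2.2, proof, (2.20)–(2.21)] -/
theorem IsPairProfile.norm_gradVec_sliceProd_le (hφ : IsPairProfile b φ) (hL : 0 < L)
    (hbL : 2 * b < L) (k : Fin N) (X : Config N) (x : Space) :
    ‖gradVec (sliceProd L φ k X) x‖ ≤
      ∑ l ∈ univ.erase k, sliceCof L φ k l X x * ‖gradVec (pairFactor L φ) (x - X l)‖ := by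
  rw [hφ.gradVec_sliceProd hL hbL]
  refine (norm_sum_le _ _).trans (sum_le_sum fun l _ => ?_)
  rw [norm_smul, Real.norm_of_nonneg (hφ.sliceCof_nonneg k l X x)]

end Slice

/-! ### The kinetic energy density of the product state, pointwise [(2.19)–(2.21)] -/

section KineticPointwise

open Finset

variable {N : ℕ} {L b : ℝ} {φ : Space → ℝ}

/-- `|∇(g : ℂ)|² = |∇g|²` for a real function coerced to `ℂ`. [folklore] -/
theorem gradSqC_ofReal {g : Space → ℝ} {y : Space} (hg : DifferentiableAt ℝ g y) :
    gradSqC (fun y => (g y : ℂ)) y = gradSq g y := by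
  unfold gradSqC gradSq
  have h : fderiv ℝ (fun y => (g y : ℂ)) y = Complex.ofRealCLM.comp (fderiv ℝ g y) :=
    (Complex.ofRealCLM.hasFDerivAt.comp y hg.hasFDerivAt).fderiv
  refine sum_congr rfl fun m _ => ?_
  rw [h, ContinuousLinearMap.comp_apply, Complex.ofRealCLM_apply, Complex.nnnorm_real]

/-- `∇(g · c) = c ∇g`. [folklore] -/
theorem gradVec_mul_const {g : Space → ℝ} {y : Space} (hg : DifferentiableAt ℝ g y) (c : ℝ) :
    gradVec (fun y => g y * c) y = c • gradVec g y := by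
  ext m
  simp only [gradVec, PiLp.toLp_apply, PiLp.smul_apply]
  rw [fderiv_mul_const hg c]
  rfl

/-- **The kinetic energy density in particle `k`, pointwise** [(2.19)–(2.21) for the product over
all pairs]: with `Φ_l = Φ(x_k - x_l)`,
`|∇_k Ψ|² ≤ ∑_{l ≠ k} |∇Φ_l|² Ψ_{∖k}² + ∑_{i ≠ j ≠ k} (Φ_i|∇Φ_i|)(Φ_j|∇Φ_j|) Ψ_{∖{i,j}}²`
(all factors other than the displayed ones are bounded by `1`).
[cite: LSSY2005, Thm. 2.2, proof, (2.19)–(2.21)] -/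
theorem IsPairProfile.gradSqC_slice_le (hφ : IsPairProfile b φ) (hL : 0 < L) (hbL : 2 * b < L)
    (k : Fin N) (X : Config N) (x : Space) :
    gradSqC (fun y => ((jastrow L φ univ (Function.update X k y) : ℝ) : ℂ)) x ≤
      (∑ l ∈ univ.erase k, gradSq (pairFactor L φ) (x - X l)) *
          ENNReal.ofReal (jastrow L φ (univ.erase k) X ^ 2) +
      ∑ i ∈ univ.erase k, ∑ j ∈ (univ.erase k).erase i,
        ENNReal.ofReal (pairFactor L φ (x - X i) * ‖gradVec (pairFactor L φ) (x - X i)‖) *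
        ENNReal.ofReal (pairFactor L φ (x - X j) * ‖gradVec (pairFactor L φ) (x - X j)‖) *
        ENNReal.ofReal (jastrow L φ ((univ.erase i).erase j) (Function.update X k x) ^ 2) := by
  -- abbreviations
  set Φ := pairFactor L φ with hΦ
  set J := jastrow L φ (univ.erase k) X with hJ
  set g : Fin N → ℝ := fun l => ‖gradVec Φ (x - X l)‖ with hg
  set π : Fin N → ℝ := fun l => sliceCof L φ k l X x with hπ
  set a : Fin N → ℝ := fun l => J * π l * g l with ha
  have hJ0 : 0 ≤ J := hφ.jastrow_nonneg _ _
  have hg0 : ∀ l, 0 ≤ g l := fun l => norm_nonneg _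
  have hπ0 : ∀ l, 0 ≤ π l := fun l => hφ.sliceCof_nonneg k l X x
  have hπ1 : ∀ l, π l ≤ 1 := fun l => hφ.sliceCof_le_one k l X x
  have hΦ0 : ∀ y, 0 ≤ Φ y := fun y => hφ.pairFactor_nonneg y
  -- Step 1: the slice is `y ↦ Π_k(X; y) · J`, with gradient `J ∇Π_k`
  have hslice : (fun y => ((jastrow L φ univ (Function.update X k y) : ℝ) : ℂ)) =
      fun y => ((sliceProd L φ k X y * J : ℝ) : ℂ) := by
    funext y; rw [hφ.jastrow_update hL hbL.le]
  have hdP := (hφ.hasFDerivAt_sliceProd hL hbL k X x).differentiableAt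
  have h1 : gradSqC (fun y => ((jastrow L φ univ (Function.update X k y) : ℝ) : ℂ)) x =
      ENNReal.ofReal ((J * ‖gradVec (sliceProd L φ k X) x‖) ^ 2) := by
    rw [hslice, gradSqC_ofReal (hdP.mul_const J), ← ofReal_norm_gradVec_sq,
      gradVec_mul_const hdP, norm_smul, Real.norm_of_nonneg hJ0]
  -- Step 2: `J |∇Π_k| ≤ ∑ a_l`
  have h2 : J * ‖gradVec (sliceProd L φ k X) x‖ ≤ ∑ l ∈ univ.erase k, a l := by
    calc J * ‖gradVec (sliceProd L φ k X) x‖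
        ≤ J * ∑ l ∈ univ.erase k, π l * g l :=
          mul_le_mul_of_nonneg_left (hφ.norm_gradVec_sliceProd_le hL hbL k X x) hJ0
      _ = ∑ l ∈ univ.erase k, a l := by
          rw [mul_sum]
          exact sum_congr rfl fun l _ => by simp only [ha, mul_assoc]
  -- Step 3: diagonal and off-diagonal bounds
  have hdiag : ∀ l, a l * a l ≤ g l ^ 2 * J ^ 2 := by
    intro l
    have : π l * π l ≤ 1 := by nlinarith [hπ0 l, hπ1 l]
    calc a l * a l = (π l * π l) * (g l ^ 2 * J ^ 2) := by simp only [ha]; ring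
      _ ≤ 1 * (g l ^ 2 * J ^ 2) := mul_le_mul_of_nonneg_right this (by positivity)
      _ = g l ^ 2 * J ^ 2 := one_mul _
  have hoff : ∀ i ∈ univ.erase k, ∀ j ∈ (univ.erase k).erase i,
      a i * a j ≤ (Φ (x - X i) * g i) * (Φ (x - X j) * g j) *
        jastrow L φ ((univ.erase i).erase j) (Function.update X k x) ^ 2 := by
    intro i hi j hj
    have hik : i ≠ k := ne_of_mem_erase hi
    have hji : j ≠ i := ne_of_mem_erase hj
    have hjk : j ≠ k := ne_of_mem_erase (mem_of_mem_erase hj)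
    set T := ((univ.erase k).erase i).erase j with hT
    set ρ := ∏ l ∈ T, Φ (x - X l) with hρ
    have hπi : π i = Φ (x - X j) * ρ := sliceCof_eq_mul hjk hji X x
    have hπj : π j = Φ (x - X i) * ρ := by
      rw [hρ, hT, erase_right_comm (a := i)]
      exact sliceCof_eq_mul hik hji.symm X x
    -- `J² ρ² ≤ Ψ_{∖{i,j}}(X')²`
    have hkS : k ∈ (univ.erase i).erase j :=
      mem_erase.mpr ⟨hjk.symm, mem_erase.mpr ⟨hik.symm, mem_univ k⟩⟩
    have hTeq : ((univ.erase i).erase j).erase k = T := by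
      rw [hT, erase_right_comm (a := j) (b := k), erase_right_comm (a := i) (b := k)]
    have hsplit := hφ.jastrow_sq_split hL hbL.le ((univ.erase i).erase j) hkS
      (Function.update X k x)
    rw [hTeq] at hsplit
    have hprod : ∏ l ∈ T, Φ (Function.update X k x k - Function.update X k x l) = ρ := by
      refine prod_congr rfl fun l hl => ?_
      have hlk : l ≠ k := ne_of_mem_erase (mem_of_mem_erase (mem_of_mem_erase hl))
      rw [Function.update_self, Function.update_of_ne hlk]
    have hTnot : k ∉ T := fun h => (ne_of_mem_erase (mem_of_mem_erase (mem_of_mem_erase h))) rfl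
    rw [hprod, jastrow_update_of_notMem hTnot] at hsplit
    have hJT : J ≤ jastrow L φ T X :=
      hφ.prod_le_jastrow (pairsOf_mono ((erase_subset _ _).trans (erase_subset _ _))) X
    have hJT2 : J ^ 2 * ρ ^ 2 ≤ jastrow L φ ((univ.erase i).erase j) (Function.update X k x) ^ 2 := by
      rw [hsplit, mul_comm]
      exact mul_le_mul_of_nonneg_left (pow_le_pow_left₀ hJ0 hJT 2) (sq_nonneg _)
    calc a i * a j = (Φ (x - X i) * g i) * (Φ (x - X j) * g j) * (J ^ 2 * ρ ^ 2) := by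
          simp only [ha, hπi, hπj]; ring
      _ ≤ _ := mul_le_mul_of_nonneg_left hJT2
          (mul_nonneg (mul_nonneg (hΦ0 _) (hg0 i)) (mul_nonneg (hΦ0 _) (hg0 j)))
  -- Step 4: assemble
  have h3 : (J * ‖gradVec (sliceProd L φ k X) x‖) ^ 2 ≤ (∑ l ∈ univ.erase k, a l) ^ 2 :=
    pow_le_pow_left₀ (mul_nonneg hJ0 (norm_nonneg _)) h2 2
  have h4 : (∑ l ∈ univ.erase k, a l) ^ 2 ≤
      ∑ l ∈ univ.erase k, g l ^ 2 * J ^ 2 +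
      ∑ i ∈ univ.erase k, ∑ j ∈ (univ.erase k).erase i, (Φ (x - X i) * g i) * (Φ (x - X j) * g j) *
        jastrow L φ ((univ.erase i).erase j) (Function.update X k x) ^ 2 := by
    rw [sq, sum_mul_sum, ← sum_add_distrib]
    refine sum_le_sum fun i hi => ?_
    rw [← add_sum_erase _ _ hi]
    exact add_le_add (hdiag i) (sum_le_sum fun j hj => hoff i hi j hj)
  rw [h1]
  refine (ENNReal.ofReal_le_ofReal (h3.trans h4)).trans (le_of_eq ?_)
  have hnn1 : ∀ l, 0 ≤ g l ^ 2 * J ^ 2 := fun l => by positivity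
  have hnn2 : ∀ i j, 0 ≤ (Φ (x - X i) * g i) * (Φ (x - X j) * g j) *
      jastrow L φ ((univ.erase i).erase j) (Function.update X k x) ^ 2 := fun i j =>
    mul_nonneg (mul_nonneg (mul_nonneg (hΦ0 _) (hg0 i)) (mul_nonneg (hΦ0 _) (hg0 j)))
      (sq_nonneg _)
  rw [ENNReal.ofReal_add (sum_nonneg fun l _ => hnn1 l)
      (sum_nonneg fun i _ => sum_nonneg fun j _ => hnn2 i j),
    ENNReal.ofReal_sum_of_nonneg (fun l _ => hnn1 l),
    ENNReal.ofReal_sum_of_nonneg (fun i _ => sum_nonneg fun j _ => hnn2 i j), sum_mul]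
  congr 1
  · refine sum_congr rfl fun l _ => ?_
    rw [ENNReal.ofReal_mul (sq_nonneg _), ofReal_norm_gradVec_sq]
  · refine sum_congr rfl fun i _ => ?_
    rw [ENNReal.ofReal_sum_of_nonneg (fun j _ => hnn2 i j)]
    refine sum_congr rfl fun j _ => ?_
    rw [ENNReal.ofReal_mul (mul_nonneg (mul_nonneg (hΦ0 _) (hg0 i)) (mul_nonneg (hΦ0 _) (hg0 j))),
      ENNReal.ofReal_mul (mul_nonneg (hΦ0 _) (hg0 i))]

end KineticPointwise

/-! ### Integrating out one particle against a translation kernel -/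

section Kernel

open Finset

variable {N : ℕ} {L b : ℝ} {φ : Space → ℝ}

/-- **Integrating out particle `a`.** If `G` does not depend on `x_a` and the kernel `F` has
`∫_Ω F(y - z) dy ≤ C` for all `z`, then `∫_{Ω^N} F(x_a - x_c) G ≤ L⁻³ C ∫_{Ω^N} G` (`c ≠ a`).
This is the Fubini step behind (2.25)–(2.27), (2.29), (2.31). [cite: LSSY2005, Thm. 2.2, proof, (2.25)–(2.27)] -/
theorem lintegral_cellN_kernel_mul_le (hL : 0 < L) {F : Space → ℝ≥0∞} (hF : Measurable F)
    {C : ℝ≥0∞} (hFC : ∀ z, ∫⁻ y in cell L, F (y - z) ≤ C) {G : Config N → ℝ≥0∞}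
    (hG : Measurable G) {a c : Fin N} (hca : c ≠ a)
    (hGa : ∀ X y, G (Function.update X a y) = G X) :
    ∫⁻ X in cellN N L, F (X a - X c) * G X ≤
      (ENNReal.ofReal L ^ 3)⁻¹ * C * ∫⁻ X in cellN N L, G X := by
  have hL3 : ENNReal.ofReal L ^ 3 ≠ 0 := pow_ne_zero _ (by simpa using hL)
  have hL3' : ENNReal.ofReal L ^ 3 ≠ ⊤ := ENNReal.pow_ne_top ENNReal.ofReal_ne_top
  set H : Config N → ℝ≥0∞ := fun X => F (X a - X c) * G X with hH
  have hHm : Measurable H :=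
    (hF.comp ((measurable_pi_apply a).sub (measurable_pi_apply c))).mul hG
  have key := lintegral_cellN_lintegral_update (L := L) a hHm
  have hslice : ∀ X : Config N, ∫⁻ y in cell L, H (Function.update X a y) ≤ C * G X := by
    intro X
    have h1 : ∀ y, H (Function.update X a y) = F (y - X c) * G X := by
      intro y
      simp only [hH, Function.update_self, Function.update_of_ne hca, hGa]
    simp_rw [h1]
    have hm : Measurable fun y => F (y - X c) := hF.comp (measurable_id.sub_const _)
    rw [lintegral_mul_const _ hm]
    exact mul_le_mul' (hFC (X c)) le_rfl
  calc ∫⁻ X in cellN N L, H X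
      = (ENNReal.ofReal L ^ 3)⁻¹ * (ENNReal.ofReal L ^ 3 * ∫⁻ X in cellN N L, H X) := by
        rw [← mul_assoc, ENNReal.inv_mul_cancel hL3 hL3', one_mul]
    _ = (ENNReal.ofReal L ^ 3)⁻¹ *
          ∫⁻ X in cellN N L, ∫⁻ y in cell L, H (Function.update X a y) := by rw [key]
    _ ≤ (ENNReal.ofReal L ^ 3)⁻¹ * ∫⁻ X in cellN N L, C * G X :=
        mul_le_mul' le_rfl (lintegral_mono hslice)
    _ = (ENNReal.ofReal L ^ 3)⁻¹ * C * ∫⁻ X in cellN N L, G X := by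
        rw [lintegral_const_mul _ hG, mul_assoc]

/-- The same with the kernel evaluated at `x_c - x_a`, for an even kernel. [folklore] -/
theorem lintegral_cellN_kernel_mul_le' (hL : 0 < L) {F : Space → ℝ≥0∞} (hF : Measurable F)
    (hFe : ∀ y, F (-y) = F y) {C : ℝ≥0∞} (hFC : ∀ z, ∫⁻ y in cell L, F (y - z) ≤ C)
    {G : Config N → ℝ≥0∞} (hG : Measurable G) {a c : Fin N} (hca : c ≠ a)
    (hGa : ∀ X y, G (Function.update X a y) = G X) :
    ∫⁻ X in cellN N L, F (X c - X a) * G X ≤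
      (ENNReal.ofReal L ^ 3)⁻¹ * C * ∫⁻ X in cellN N L, G X := by
  have h : ∀ X : Config N, F (X c - X a) = F (X a - X c) := fun X => by rw [← neg_sub, hFe]
  simp_rw [h]
  exact lintegral_cellN_kernel_mul_le hL hF hFC hG hca hGa

/-- The three-body kernel `(Φ|∇Φ|)(y)` as an `ℝ≥0∞`-valued function. [cite: LSSY2005, Thm. 2.2, proof, (2.21), (2.31)] -/
def kKernel (L : ℝ) (φ : Space → ℝ) (y : Space) : ℝ≥0∞ :=
  ENNReal.ofReal (pairFactor L φ y * ‖gradVec (pairFactor L φ) y‖)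

/-- The three-body kernel is measurable. [folklore] -/
theorem IsPairProfile.measurable_kKernel (hφ : IsPairProfile b φ) (hL : 0 < L) (hbL : 2 * b < L) :
    Measurable (kKernel L φ) :=
  ((hφ.contDiff_pairFactor hL hbL).continuous.mul
    (continuous_gradVec (hφ.contDiff_pairFactor hL hbL)).norm).measurable.ennreal_ofReal

/-- The three-body kernel is even. [folklore] -/
theorem IsPairProfile.kKernel_neg (hφ : IsPairProfile b φ) (hL : 0 < L) (hbL : 2 * b < L)
    (y : Space) : kKernel L φ (-y) = kKernel L φ y := by
  rw [kKernel, kKernel, hφ.pairFactor_neg hL hbL.le, hφ.norm_gradVec_pairFactor_neg hL hbL]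

/-- `∫_Ω (Φ|∇Φ|)(y - z) dy ≤ K`. [cite: LSSY2005, Thm. 2.2, proof, (2.31)] -/
theorem IsPairProfile.lintegral_cell_kKernel_le (hφ : IsPairProfile b φ) (hL : 0 < L)
    (hbL : 2 * b < L) (z : Space) : ∫⁻ y in cell L, kKernel L φ (y - z) ≤ profileK φ := by
  have h := hφ.lintegral_cell_K_le hL hbL z
  have h' : ∀ y, kKernel L φ (y - z) = ENNReal.ofReal
      (pairFactor L φ (z - y) * ‖gradVec (pairFactor L φ) (z - y)‖) := fun y => by
    rw [← hφ.kKernel_neg hL hbL, neg_sub]; rfl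
  simp_rw [h']
  exact h

/-- `|∇Φ|²` is measurable. [folklore] -/
theorem IsPairProfile.measurable_gradSq_pairFactor (hφ : IsPairProfile b φ) (hL : 0 < L)
    (hbL : 2 * b < L) : Measurable (gradSq (pairFactor L φ)) :=
  measurable_gradSq (hφ.contDiff_pairFactor hL hbL)

/-- `|∇Φ|²` is even. [folklore] -/
theorem IsPairProfile.gradSq_pairFactor_neg (hφ : IsPairProfile b φ) (hL : 0 < L)
    (hbL : 2 * b < L) (y : Space) : gradSq (pairFactor L φ) (-y) = gradSq (pairFactor L φ) y := by
  rw [← ofReal_norm_gradVec_sq, ← ofReal_norm_gradVec_sq, hφ.norm_gradVec_pairFactor_neg hL hbL]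

end Kernel

/-! ### The kinetic and potential energies of the product state [(2.26)–(2.31)] -/

section Energies

open Finset

variable {N : ℕ} {L b : ℝ} {φ : Space → ℝ}

/-- The complex-valued (unnormalised) product state `Ψ = ∏_{i<j} Φ(xᵢ - xⱼ)`.
[cite: LSSY2005, Thm. 2.2, proof, (2.15)–(2.16); Dyson1957] -/
def jastrowC (L : ℝ) (φ : Space → ℝ) (X : Config N) : ℂ := ((jastrow L φ univ X : ℝ) : ℂ)

/-- The complex-valued product state is differentiable. [folklore] -/
theorem IsPairProfile.differentiable_jastrowC (hφ : IsPairProfile b φ) (hL : 0 < L)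
    (hbL : 2 * b < L) : Differentiable ℝ (jastrowC (N := N) L φ) :=
  Complex.ofRealCLM.differentiable.comp
    ((hφ.contDiff_jastrow hL hbL univ).differentiable one_ne_zero)

/-- **Kinetic energy of the product state** [(2.19)–(2.21) integrated as in (2.26)–(2.31)]:
`∫_{Ω^N} |∇Ψ|² ≤ ∑_k ∑_{l ≠ k} L⁻³ (∫|∇φ|²) ‖Ψ_{∖k}‖² + ∑_k ∑_{i ≠ j ≠ k} L⁻⁶ K² ‖Ψ_{∖{i,j}}‖²`.
[cite: LSSY2005, Thm. 2.2, proof, (2.26)–(2.31)] -/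
theorem IsPairProfile.lintegral_kinetic_le (hφ : IsPairProfile b φ) (hL : 0 < L)
    (hbL : 2 * b < L) :
    ∫⁻ X in cellN N L, kineticDensity (jastrowC L φ) X ≤
      ∑ k : Fin N, ∑ _l ∈ univ.erase k,
        (ENNReal.ofReal L ^ 3)⁻¹ * (∫⁻ x, gradSq φ x) * jastrowNormSq L φ (univ.erase k) +
      ∑ k : Fin N, ∑ i ∈ univ.erase k, ∑ j ∈ (univ.erase k).erase i,
        (ENNReal.ofReal L ^ 3)⁻¹ * profileK φ * ((ENNReal.ofReal L ^ 3)⁻¹ * profileK φ *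
          jastrowNormSq L φ ((univ.erase i).erase j)) := by
  have hL3 : ENNReal.ofReal L ^ 3 ≠ 0 := pow_ne_zero _ (by simpa using hL)
  have hL3' : ENNReal.ofReal L ^ 3 ≠ ⊤ := ENNReal.pow_ne_top ENNReal.ofReal_ne_top
  set Φ := pairFactor L φ with hΦ
  -- the majorant of `|∇_k Ψ|²` as a function of the full configuration
  set D : Fin N → Config N → ℝ≥0∞ := fun k Y =>
    ∑ l ∈ univ.erase k, gradSq Φ (Y k - Y l) *
      ENNReal.ofReal (jastrow L φ (univ.erase k) Y ^ 2) with hD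
  set T : Fin N → Config N → ℝ≥0∞ := fun k Y =>
    ∑ i ∈ univ.erase k, ∑ j ∈ (univ.erase k).erase i,
      kKernel L φ (Y k - Y i) * (kKernel L φ (Y k - Y j) *
        ENNReal.ofReal (jastrow L φ ((univ.erase i).erase j) Y ^ 2)) with hT
  have hmJ : ∀ S : Finset (Fin N), Measurable fun Y : Config N =>
      ENNReal.ofReal (jastrow L φ S Y ^ 2) := fun S => hφ.measurable_jastrow_sq hL hbL S
  have hmG : ∀ k l : Fin N, Measurable fun Y : Config N => gradSq Φ (Y k - Y l) := fun k l =>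
    (hφ.measurable_gradSq_pairFactor hL hbL).comp
      ((measurable_pi_apply k).sub (measurable_pi_apply l))
  have hmK : ∀ k l : Fin N, Measurable fun Y : Config N => kKernel L φ (Y k - Y l) := fun k l =>
    (hφ.measurable_kKernel hL hbL).comp ((measurable_pi_apply k).sub (measurable_pi_apply l))
  have hDm : ∀ k, Measurable (D k) := fun k =>
    Finset.measurable_sum _ fun l _ => (hmG k l).fun_mul (hmJ _)
  have hTm : ∀ k, Measurable (T k) := fun k =>
    Finset.measurable_sum _ fun i _ => Finset.measurable_sum _ fun j _ =>
      (hmK k i).fun_mul ((hmK k j).fun_mul (hmJ _))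
  -- Step 1: pointwise, `|∇_k Ψ|²(update X k x) ≤ (D k + T k)(update X k x)`
  have hpt : ∀ (k : Fin N) (X : Config N) (x : Space),
      gradSqC (fun y => jastrowC L φ (Function.update X k y)) x ≤
        D k (Function.update X k x) + T k (Function.update X k x) := by
    intro k X x
    refine (hφ.gradSqC_slice_le hL hbL k X x).trans (le_of_eq ?_)
    simp only [hD, hT, Function.update_self, jastrow_update_of_notMem (notMem_erase k univ),
      sum_mul]
    congr 1
    · refine sum_congr rfl fun l hl => ?_
      rw [Function.update_of_ne (ne_of_mem_erase hl)]
    · refine sum_congr rfl fun i hi => sum_congr rfl fun j hj => ?_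
      rw [Function.update_of_ne (ne_of_mem_erase hi),
        Function.update_of_ne (ne_of_mem_erase (mem_of_mem_erase hj)), kKernel, kKernel, mul_assoc]
  -- Step 2: integrate: `L⁻³ ∫∫ |∇_k Ψ|² ≤ ∫ D k + ∫ T k`
  have hk : ∀ k : Fin N, (ENNReal.ofReal L ^ 3)⁻¹ *
      ∫⁻ X in cellN N L, ∫⁻ x in cell L, gradSqC (fun y => jastrowC L φ (Function.update X k y)) x ≤
        (∫⁻ X in cellN N L, D k X) + ∫⁻ X in cellN N L, T k X := by
    intro k
    calc (ENNReal.ofReal L ^ 3)⁻¹ * ∫⁻ X in cellN N L, ∫⁻ x in cell L,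
          gradSqC (fun y => jastrowC L φ (Function.update X k y)) x
        ≤ (ENNReal.ofReal L ^ 3)⁻¹ * ∫⁻ X in cellN N L, ∫⁻ x in cell L,
            (D k + T k) (Function.update X k x) :=
          mul_le_mul' le_rfl (lintegral_mono fun X => lintegral_mono fun x => hpt k X x)
      _ = ∫⁻ X in cellN N L, (D k + T k) X := by
          rw [lintegral_cellN_lintegral_update k ((hDm k).add (hTm k)), ← mul_assoc,
            ENNReal.inv_mul_cancel hL3 hL3', one_mul]
      _ = (∫⁻ X in cellN N L, D k X) + ∫⁻ X in cellN N L, T k X :=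
          lintegral_add_left (hDm k) _
  -- Step 3: the diagonal terms
  have hDk : ∀ k : Fin N, ∫⁻ X in cellN N L, D k X ≤ ∑ _l ∈ univ.erase k,
      (ENNReal.ofReal L ^ 3)⁻¹ * (∫⁻ x, gradSq φ x) * jastrowNormSq L φ (univ.erase k) := by
    intro k
    simp only [hD]
    rw [lintegral_finsetSum _ fun l _ => (hmG k l).fun_mul (hmJ _)]
    refine sum_le_sum fun l hl => ?_
    exact lintegral_cellN_kernel_mul_le hL (hφ.measurable_gradSq_pairFactor hL hbL)
      (hφ.lintegral_cell_gradSq_le hL hbL) (hmJ _) (ne_of_mem_erase hl)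
      (fun X y => by rw [jastrow_update_of_notMem (notMem_erase k univ)])
  -- Step 4: the three-body terms
  have hTk : ∀ k : Fin N, ∫⁻ X in cellN N L, T k X ≤
      ∑ i ∈ univ.erase k, ∑ j ∈ (univ.erase k).erase i,
        (ENNReal.ofReal L ^ 3)⁻¹ * profileK φ * ((ENNReal.ofReal L ^ 3)⁻¹ * profileK φ *
          jastrowNormSq L φ ((univ.erase i).erase j)) := by
    intro k
    simp only [hT]
    rw [lintegral_finsetSum _ fun i _ => Finset.measurable_sum _ fun j _ =>
      (hmK k i).fun_mul ((hmK k j).fun_mul (hmJ _))]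
    refine sum_le_sum fun i hi => ?_
    rw [lintegral_finsetSum _ fun j _ => (hmK k i).fun_mul ((hmK k j).fun_mul (hmJ _))]
    refine sum_le_sum fun j hj => ?_
    have hik : i ≠ k := ne_of_mem_erase hi
    have hji : j ≠ i := ne_of_mem_erase hj
    have hjk : j ≠ k := ne_of_mem_erase (mem_of_mem_erase hj)
    have hiS : i ∉ (univ.erase i).erase j := fun h => (notMem_erase i univ) (mem_of_mem_erase h)
    have hjS : j ∉ (univ.erase i).erase j := notMem_erase j _
    -- integrate out `x_i`, then `x_j`
    calc ∫⁻ X in cellN N L, kKernel L φ (X k - X i) * (kKernel L φ (X k - X j) *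
          ENNReal.ofReal (jastrow L φ ((univ.erase i).erase j) X ^ 2))
        ≤ (ENNReal.ofReal L ^ 3)⁻¹ * profileK φ * ∫⁻ X in cellN N L, kKernel L φ (X k - X j) *
            ENNReal.ofReal (jastrow L φ ((univ.erase i).erase j) X ^ 2) :=
          lintegral_cellN_kernel_mul_le' hL (hφ.measurable_kKernel hL hbL) (hφ.kKernel_neg hL hbL)
            (hφ.lintegral_cell_kKernel_le hL hbL) ((hmK k j).fun_mul (hmJ _)) hik.symm
            (fun X y => by
              rw [Function.update_of_ne hik.symm, Function.update_of_ne hji,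
                jastrow_update_of_notMem hiS])
      _ ≤ (ENNReal.ofReal L ^ 3)⁻¹ * profileK φ * ((ENNReal.ofReal L ^ 3)⁻¹ * profileK φ *
            jastrowNormSq L φ ((univ.erase i).erase j)) := by
          refine mul_le_mul' le_rfl ?_
          exact lintegral_cellN_kernel_mul_le' hL (hφ.measurable_kKernel hL hbL)
            (hφ.kKernel_neg hL hbL) (hφ.lintegral_cell_kKernel_le hL hbL) (hmJ _) hjk.symm
            (fun X y => by rw [jastrow_update_of_notMem hjS])
  -- Step 5: sum over `k`
  rw [← sum_lintegral_gradSqC_slice hL (hφ.differentiable_jastrowC hL hbL), ← sum_add_distrib]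
  exact sum_le_sum fun k _ => (hk k).trans (add_le_add (hDk k) (hTk k))

/-- **Potential energy of the product state** [(2.26)–(2.27)]:
`∫_{Ω^N} ∑_{i<j} v^per(xᵢ-xⱼ) Ψ² ≤ ∑_{i<j} L⁻³ (∫ v φ²) ‖Ψ_{∖i}‖²`.
[cite: LSSY2005, Thm. 2.2, proof, (2.26)–(2.27)] -/
theorem IsPairProfile.lintegral_potential_le (hφ : IsPairProfile b φ) (hL : 0 < L)
    (hbL : 2 * b < L) {v : ℝ → ℝ≥0∞} (hv : Measurable v) :
    ∫⁻ X in cellN N L, periodicInteraction v L X * ENNReal.ofReal (jastrow L φ univ X ^ 2) ≤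
      ∑ i : Fin N, ∑ _j ∈ univ.filter (i < ·),
        (ENNReal.ofReal L ^ 3)⁻¹ * (∫⁻ x, v ‖x‖ * ENNReal.ofReal (φ x ^ 2)) *
          jastrowNormSq L φ (univ.erase i) := by
  set W : Space → ℝ≥0∞ := latSum L fun u => v ‖u‖ * ENNReal.ofReal (φ u ^ 2) with hW
  have hWm : Measurable W := measurable_latSum ((hv.comp measurable_norm).fun_mul
    (hφ.contDiff.continuous.pow 2).measurable.ennreal_ofReal)
  have hmJ : ∀ S : Finset (Fin N), Measurable fun Y : Config N =>
      ENNReal.ofReal (jastrow L φ S Y ^ 2) := fun S => hφ.measurable_jastrow_sq hL hbL S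
  have hmV : ∀ i j : Fin N, Measurable fun X : Config N =>
      periodizedPotential v L (X i - X j) * ENNReal.ofReal (jastrow L φ univ X ^ 2) := fun i j =>
    ((measurable_latSum (hv.comp measurable_norm)).comp
      ((measurable_pi_apply i).sub (measurable_pi_apply j))).fun_mul (hmJ _)
  -- pointwise: `v^per(xᵢ-xⱼ) Ψ² ≤ (vφ²)^per(xᵢ-xⱼ) Ψ_{∖i}²`
  have hpt : ∀ (i j : Fin N), i ≠ j → ∀ X : Config N,
      periodizedPotential v L (X i - X j) * ENNReal.ofReal (jastrow L φ univ X ^ 2) ≤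
        W (X i - X j) * ENNReal.ofReal (jastrow L φ (univ.erase i) X ^ 2) := by
    intro i j hij X
    have hj : j ∈ univ.erase i := mem_erase.mpr ⟨hij.symm, mem_univ j⟩
    have hsplit := hφ.jastrow_sq_split hL hbL.le univ (mem_univ i) X
    have hP : ∏ l ∈ univ.erase i, pairFactor L φ (X i - X l) ≤ pairFactor L φ (X i - X j) := by
      rw [← mul_prod_erase _ _ hj]
      exact mul_le_of_le_one_right (hφ.pairFactor_nonneg _)
        (prod_le_one (fun _ _ => hφ.pairFactor_nonneg _) fun _ _ => hφ.pairFactor_le_one _)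
    have hP0 : 0 ≤ ∏ l ∈ univ.erase i, pairFactor L φ (X i - X l) :=
      prod_nonneg fun _ _ => hφ.pairFactor_nonneg _
    have h1 : jastrow L φ univ X ^ 2 ≤
        pairFactor L φ (X i - X j) ^ 2 * jastrow L φ (univ.erase i) X ^ 2 := by
      rw [hsplit]
      exact mul_le_mul_of_nonneg_right (pow_le_pow_left₀ hP0 hP 2) (sq_nonneg _)
    calc periodizedPotential v L (X i - X j) * ENNReal.ofReal (jastrow L φ univ X ^ 2)
        ≤ periodizedPotential v L (X i - X j) * (ENNReal.ofReal (pairFactor L φ (X i - X j) ^ 2) *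
            ENNReal.ofReal (jastrow L φ (univ.erase i) X ^ 2)) := by
          refine mul_le_mul' le_rfl ?_
          rw [← ENNReal.ofReal_mul (sq_nonneg _)]
          exact ENNReal.ofReal_le_ofReal h1
      _ = periodizedPotential v L (X i - X j) * ENNReal.ofReal (pairFactor L φ (X i - X j) ^ 2) *
            ENNReal.ofReal (jastrow L φ (univ.erase i) X ^ 2) := (mul_assoc _ _ _).symm
      _ ≤ W (X i - X j) * ENNReal.ofReal (jastrow L φ (univ.erase i) X ^ 2) :=
          mul_le_mul' (hφ.periodizedPotential_mul_le hL hbL.le v _) le_rfl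
  -- integrate
  have hsum : ∀ X : Config N, periodicInteraction v L X * ENNReal.ofReal (jastrow L φ univ X ^ 2) =
      ∑ i : Fin N, ∑ j ∈ univ.filter (i < ·),
        periodizedPotential v L (X i - X j) * ENNReal.ofReal (jastrow L φ univ X ^ 2) := by
    intro X
    rw [periodicInteraction, sum_mul]
    exact sum_congr rfl fun i _ => sum_mul _ _ _
  simp_rw [hsum]
  rw [lintegral_finsetSum _ fun i _ => Finset.measurable_sum _ fun j _ => hmV i j]
  refine sum_le_sum fun i _ => ?_
  rw [lintegral_finsetSum _ fun j _ => hmV i j]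
  refine sum_le_sum fun j hj => ?_
  have hij : i ≠ j := (mem_filter.mp hj).2.ne
  calc ∫⁻ X in cellN N L, periodizedPotential v L (X i - X j) *
        ENNReal.ofReal (jastrow L φ univ X ^ 2)
      ≤ ∫⁻ X in cellN N L, W (X i - X j) * ENNReal.ofReal (jastrow L φ (univ.erase i) X ^ 2) :=
        lintegral_mono fun X => hpt i j hij X
    _ ≤ _ := lintegral_cellN_kernel_mul_le hL hWm
        (fun z => (hφ.lintegral_cell_potential_eq hL hv z).le) (hmJ _) hij.symm
        (fun X y => by rw [jastrow_update_of_notMem (notMem_erase i univ)])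

end Energies

/-! ### The normalised product state as a periodic trial state -/

section TrialState

open Finset

variable {N : ℕ} {L b : ℝ} {φ : Space → ℝ}

/-- `(‖(r : ℂ)‖₊)² = r²` in `ℝ≥0∞`. [folklore] -/
theorem ennnorm_real_sq (r : ℝ) : ((‖((r : ℝ) : ℂ)‖₊ : ℝ≥0∞)) ^ 2 = ENNReal.ofReal (r ^ 2) := by
  rw [Complex.nnnorm_real, ← enorm_eq_nnnorm, Real.enorm_eq_ofReal_abs,
    ← ENNReal.ofReal_pow (abs_nonneg _), sq_abs]

/-- The product state is `Lℤ³`-periodic in each particle. [cite: LSSY2005, Thm. 2.2, proof, (2.16)] -/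
theorem jastrow_add_single (hL : L ≠ 0) (S : Finset (Fin N)) (X : Config N) (i : Fin N)
    (k : Fin 3) :
    jastrow L φ S (X + Pi.single i (EuclideanSpace.single k L)) = jastrow L φ S X := by
  refine prod_congr rfl fun p hp => ?_
  have hlt := (mem_pairsOf.mp hp).2.2
  simp only [Pi.add_apply]
  by_cases h1 : p.1 = i
  · have h2 : p.2 ≠ i := fun h => hlt.ne (h1.trans h.symm)
    rw [h1, Pi.single_eq_same, Pi.single_eq_of_ne h2, add_zero, single_eq_latticeVec,
      show X i + latticeVec L (Pi.single k 1) - X p.2 = X i - X p.2 + latticeVec L (Pi.single k 1)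
        by abel, pairFactor_add_latticeVec hL]
  · by_cases h2 : p.2 = i
    · rw [h2, Pi.single_eq_same, Pi.single_eq_of_ne h1, add_zero, single_eq_latticeVec,
        show X p.1 - (X i + latticeVec L (Pi.single k 1)) =
          X p.1 - X i - latticeVec L (Pi.single k 1) by abel, pairFactor_sub_latticeVec hL]
    · rw [Pi.single_eq_of_ne h1, Pi.single_eq_of_ne h2, add_zero, add_zero]

/-- The product state over all pairs is Bose-symmetric. [cite: LSSY2005, Thm. 2.2, proof, first paragraph] -/
theorem IsPairProfile.jastrow_comp_perm (hφ : IsPairProfile b φ) (hL : 0 < L) (hbL : 2 * b ≤ L)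
    (σ : Equiv.Perm (Fin N)) (X : Config N) :
    jastrow L φ univ (X ∘ σ) = jastrow L φ univ X := by
  have h := hφ.jastrow_sq hL hbL univ (X ∘ σ)
  have h' := hφ.jastrow_sq hL hbL univ X
  have key : ∏ i ∈ (univ : Finset (Fin N)), ∏ j ∈ univ.erase i,
      pairFactor L φ ((X ∘ σ) i - (X ∘ σ) j) =
        ∏ i ∈ (univ : Finset (Fin N)), ∏ j ∈ univ.erase i, pairFactor L φ (X i - X j) := by
    have inner : ∀ i, ∏ j ∈ univ.erase i, pairFactor L φ (X (σ i) - X (σ j)) =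
        ∏ j ∈ univ.erase (σ i), pairFactor L φ (X (σ i) - X j) := by
      intro i
      rw [show univ.erase (σ i) = (univ.erase i).map σ.toEmbedding by
        rw [Finset.map_erase, Finset.map_univ_equiv]; rfl, Finset.prod_map]
      rfl
    simp only [Function.comp_apply, inner]
    exact Equiv.prod_comp σ (fun i => ∏ j ∈ univ.erase i, pairFactor L φ (X i - X j))
  rw [key, ← h'] at h
  exact (sq_eq_sq₀ (hφ.jastrow_nonneg _ _) (hφ.jastrow_nonneg _ _)).mp h

/-- `ν_S = ‖Ψ_S‖²` as a real number (it is finite). [cite: LSSY2005, Thm. 2.2, proof, (2.22)] -/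
def jastrowNormR (L : ℝ) (φ : Space → ℝ) (S : Finset (Fin N)) : ℝ := (jastrowNormSq L φ S).toReal

/-- `ν_S` as an extended real is `‖Ψ_S‖²`. [folklore] -/
theorem IsPairProfile.ofReal_jastrowNormR (hφ : IsPairProfile b φ) (S : Finset (Fin N)) :
    ENNReal.ofReal (jastrowNormR L φ S) = jastrowNormSq L φ S :=
  ENNReal.ofReal_toReal (hφ.jastrowNormSq_ne_top S)

/-- `ν_S ≥ 0`. [folklore] -/
theorem jastrowNormR_nonneg (S : Finset (Fin N)) : 0 ≤ jastrowNormR L φ S := ENNReal.toReal_nonneg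

/-- `‖Ψ_∅‖² = |Ω^N| = L^{3N}`. [folklore] -/
theorem jastrowNormR_empty (hL : 0 < L) : jastrowNormR (N := N) L φ ∅ = (L ^ 3) ^ N := by
  unfold jastrowNormR jastrowNormSq
  have h : (fun X : Config N => ENNReal.ofReal (jastrow L φ ∅ X ^ 2)) = fun _ => 1 := by
    funext X; simp [jastrow, pairsOf]
  rw [h, setLIntegral_const, one_mul, volume_cellN, ENNReal.toReal_pow, ENNReal.toReal_pow,
    ENNReal.toReal_ofReal hL.le]

/-- **One-particle elimination in real numbers**: `ν_{S∖a} ≤ ν_S + |S∖a| (I/L³) ν_{S∖a}`.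
[cite: LSSY2005, Thm. 2.2, proof, (2.22)–(2.26)] -/
theorem IsPairProfile.jastrowNormR_erase_le (hφ : IsPairProfile b φ) (hL : 0 < L)
    (hbL : 2 * b < L) {I : ℝ} (hI0 : 0 ≤ I) (hI : profileDefect φ ≤ ENNReal.ofReal I)
    (S : Finset (Fin N)) {a : Fin N} (ha : a ∈ S) :
    jastrowNormR L φ (S.erase a) ≤
      jastrowNormR L φ S + (S.erase a).card * (I / L ^ 3) * jastrowNormR L φ (S.erase a) := by
  have h := hφ.jastrowNormSq_erase_le hL hbL S ha
  have hL3 : (ENNReal.ofReal L ^ 3)⁻¹ = ENNReal.ofReal ((L ^ 3)⁻¹) := by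
    rw [← ENNReal.ofReal_pow hL.le, ENNReal.ofReal_inv_of_pos (by positivity)]
  have hν0 := jastrowNormR_nonneg (L := L) (φ := φ) S
  have hν1 := jastrowNormR_nonneg (L := L) (φ := φ) (S.erase a)
  have h2 : jastrowNormSq L φ (S.erase a) ≤ ENNReal.ofReal
      (jastrowNormR L φ S + (S.erase a).card * (I / L ^ 3) * jastrowNormR L φ (S.erase a)) := by
    refine h.trans ?_
    rw [← hφ.ofReal_jastrowNormR S, ← hφ.ofReal_jastrowNormR (S.erase a), hL3]
    calc ENNReal.ofReal (jastrowNormR L φ S) + ((S.erase a).card : ℝ≥0∞) *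
          (ENNReal.ofReal (L ^ 3)⁻¹ * profileDefect φ * ENNReal.ofReal (jastrowNormR L φ (S.erase a)))
        ≤ ENNReal.ofReal (jastrowNormR L φ S) + ((S.erase a).card : ℝ≥0∞) *
          (ENNReal.ofReal (L ^ 3)⁻¹ * ENNReal.ofReal I *
            ENNReal.ofReal (jastrowNormR L φ (S.erase a))) := by
          gcongr
      _ = _ := by
          rw [← ENNReal.ofReal_natCast, ← ENNReal.ofReal_mul (by positivity),
            ← ENNReal.ofReal_mul (by positivity), ← ENNReal.ofReal_mul (by positivity),
            ← ENNReal.ofReal_add hν0 (by positivity)]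
          congr 1
          field_simp
  have := ENNReal.toReal_mono ENNReal.ofReal_ne_top h2
  rwa [ENNReal.toReal_ofReal (by positivity)] at this

/-- The elimination bound in solved form: `ν_{S∖a} ≤ L³/(L³ - (N-1)I) · ν_S` when `(N-1)I < L³`.
[cite: LSSY2005, Thm. 2.2, proof, (2.26)] -/
theorem IsPairProfile.jastrowNormR_erase_le' (hφ : IsPairProfile b φ) (hL : 0 < L)
    (hbL : 2 * b < L) {I : ℝ} (hI0 : 0 ≤ I) (hI : profileDefect φ ≤ ENNReal.ofReal I)
    (hNI : ((N : ℝ) - 1) * I < L ^ 3) (S : Finset (Fin N)) {a : Fin N} (ha : a ∈ S) :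
    jastrowNormR L φ (S.erase a) ≤ L ^ 3 / (L ^ 3 - ((N : ℝ) - 1) * I) * jastrowNormR L φ S := by
  have h := hφ.jastrowNormR_erase_le hL hbL hI0 hI S ha
  set t := jastrowNormR L φ (S.erase a) with ht_def
  set s := jastrowNormR L φ S with hs_def
  have ht : 0 ≤ t := jastrowNormR_nonneg _
  have hcard : ((S.erase a).card : ℝ) ≤ (N : ℝ) - 1 := by
    have h1 : (S.erase a).card + 1 ≤ N := by
      rw [Finset.card_erase_add_one ha]
      exact (Finset.card_le_univ S).trans_eq (Fintype.card_fin N)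
    have h2 : ((S.erase a).card : ℝ) + 1 ≤ N := by exact_mod_cast h1
    linarith
  have hL3 : 0 < L ^ 3 := by positivity
  have hden : 0 < L ^ 3 - ((N : ℝ) - 1) * I := by linarith
  have h2 : t ≤ s + ((N : ℝ) - 1) * (I / L ^ 3) * t := by
    have : ((S.erase a).card : ℝ) * (I / L ^ 3) * t ≤ ((N : ℝ) - 1) * (I / L ^ 3) * t :=
      mul_le_mul_of_nonneg_right (mul_le_mul_of_nonneg_right hcard (by positivity)) ht
    linarith
  rw [div_mul_eq_mul_div, le_div_iff₀ hden]
  have h4 : t * L ^ 3 ≤ (s + ((N : ℝ) - 1) * (I / L ^ 3) * t) * L ^ 3 :=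
    mul_le_mul_of_nonneg_right h2 hL3.le
  have h5 : ((N : ℝ) - 1) * (I / L ^ 3) * t * L ^ 3 = ((N : ℝ) - 1) * I * t := by
    field_simp
  nlinarith [h4, h5]

/-- The norms are positive: `ν_S > 0` (from `ν_∅ = L^{3N}` and the elimination bound).
[cite: LSSY2005, Thm. 2.2, proof, (2.26)] -/
theorem IsPairProfile.jastrowNormR_pos (hφ : IsPairProfile b φ) (hL : 0 < L) (hbL : 2 * b < L)
    {I : ℝ} (hI0 : 0 ≤ I) (hI : profileDefect φ ≤ ENNReal.ofReal I)
    (hNI : ((N : ℝ) - 1) * I < L ^ 3) (S : Finset (Fin N)) : 0 < jastrowNormR L φ S := by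
  induction S using Finset.induction_on with
  | empty => rw [jastrowNormR_empty hL]; positivity
  | insert a S haS ih =>
    have h := hφ.jastrowNormR_erase_le' hL hbL hI0 hI hNI (insert a S) (mem_insert_self a S)
    rw [erase_insert haS] at h
    have hL3 : 0 < L ^ 3 := by positivity
    have hD : 0 < L ^ 3 / (L ^ 3 - ((N : ℝ) - 1) * I) := div_pos hL3 (by linarith)
    by_contra hneg
    have h0 : jastrowNormR L φ (insert a S) = 0 :=
      le_antisymm (not_lt.mp hneg) (jastrowNormR_nonneg _)
    rw [h0, mul_zero] at h
    linarith

/-- **The trial state** `Ψ/‖Ψ‖` with `Ψ = ∏_{i<j} Φ(xᵢ - xⱼ)`: `C¹`, periodic, Bose-symmetric and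
normalised on `Ω^N`. [cite: LSSY2005, Thm. 2.2, proof, (2.15)–(2.18); Dyson1957] -/
def IsPairProfile.trialState (hφ : IsPairProfile b φ) (hL : 0 < L) (hbL : 2 * b < L)
    (hν : 0 < jastrowNormR L φ (univ : Finset (Fin N))) : PeriodicTrialState N L where
  ψ X := ((jastrow L φ univ X * (Real.sqrt (jastrowNormR L φ (univ : Finset (Fin N))))⁻¹ : ℝ) : ℂ)
  contDiff := Complex.ofRealCLM.contDiff.comp ((hφ.contDiff_jastrow hL hbL univ).mul contDiff_const)
  periodic X i k := by simp only [jastrow_add_single hL.ne']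
  symm σ X := by simp only [hφ.jastrow_comp_perm hL hbL.le]
  norm_eq := by
    have h1 : ∀ X : Config N, ((‖((jastrow L φ univ X *
        (Real.sqrt (jastrowNormR L φ (univ : Finset (Fin N))))⁻¹ : ℝ) : ℂ)‖₊ : ℝ≥0∞)) ^ 2 =
          ENNReal.ofReal (jastrow L φ univ X ^ 2) *
            ENNReal.ofReal (jastrowNormR L φ (univ : Finset (Fin N)))⁻¹ := by
      intro X
      rw [ennnorm_real_sq, mul_pow, inv_pow, Real.sq_sqrt hν.le, ENNReal.ofReal_mul (sq_nonneg _)]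
    simp_rw [h1]
    rw [lintegral_mul_const _ (hφ.measurable_jastrow_sq hL hbL univ), ← jastrowNormSq,
      ← hφ.ofReal_jastrowNormR, ← ENNReal.ofReal_mul hν.le, mul_inv_cancel₀ hν.ne',
      ENNReal.ofReal_one]

/-- Scaling of the kinetic energy density: `|∇(cΨ)|² = c² |∇Ψ|²`. [folklore] -/
theorem kineticDensity_real_mul_const {Ψ : Config N → ℝ} (hΨ : Differentiable ℝ Ψ) (c : ℝ)
    (X : Config N) :
    kineticDensity (fun X => ((Ψ X * c : ℝ) : ℂ)) X =
      ENNReal.ofReal (c ^ 2) * kineticDensity (fun X => ((Ψ X : ℝ) : ℂ)) X := by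
  unfold kineticDensity
  rw [mul_sum]
  refine sum_congr rfl fun i _ => ?_
  rw [mul_sum]
  refine sum_congr rfl fun m _ => ?_
  have h1 : fderiv ℝ (fun X => ((Ψ X * c : ℝ) : ℂ)) X =
      Complex.ofRealCLM.comp (c • fderiv ℝ Ψ X) := by
    rw [← fderiv_mul_const (hΨ X) c]
    exact (Complex.ofRealCLM.hasFDerivAt.comp X ((hΨ X).mul_const c).hasFDerivAt).fderiv
  have h2 : fderiv ℝ (fun X => ((Ψ X : ℝ) : ℂ)) X = Complex.ofRealCLM.comp (fderiv ℝ Ψ X) :=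
    (Complex.ofRealCLM.hasFDerivAt.comp X (hΨ X).hasFDerivAt).fderiv
  rw [h1, h2, ContinuousLinearMap.comp_apply, ContinuousLinearMap.comp_apply,
    Complex.ofRealCLM_apply, Complex.ofRealCLM_apply]
  rw [show (c • fderiv ℝ Ψ X) (Pi.single i (EuclideanSpace.single m (1 : ℝ))) =
      c * fderiv ℝ Ψ X (Pi.single i (EuclideanSpace.single m (1 : ℝ))) from rfl,
    Complex.ofReal_mul, nnnorm_mul, ENNReal.coe_mul, mul_pow, ennnorm_real_sq]

/-- The energy of the trial state is `‖Ψ‖⁻²` times that of `Ψ`. [cite: LSSY2005, Thm. 2.2, proof, (2.26)] -/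
theorem IsPairProfile.periodicEnergy_trialState (hφ : IsPairProfile b φ) (hL : 0 < L)
    (hbL : 2 * b < L) (hν : 0 < jastrowNormR L φ (univ : Finset (Fin N))) (v : ℝ → ℝ≥0∞) :
    periodicEnergy v (hφ.trialState hL hbL hν) =
      ENNReal.ofReal (jastrowNormR L φ (univ : Finset (Fin N)))⁻¹ *
        ∫⁻ X in cellN N L, kineticDensity (jastrowC L φ) X +
          periodicInteraction v L X * ENNReal.ofReal (jastrow L φ univ X ^ 2) := by
  set ν := jastrowNormR L φ (univ : Finset (Fin N)) with hν_def
  unfold periodicEnergy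
  rw [← lintegral_const_mul' _ _ ENNReal.ofReal_ne_top]
  refine lintegral_congr fun X => ?_
  have hd : Differentiable ℝ (jastrow L φ (univ : Finset (Fin N))) :=
    (hφ.contDiff_jastrow hL hbL univ).differentiable one_ne_zero
  have hkin : kineticDensity (hφ.trialState hL hbL hν).ψ X =
      ENNReal.ofReal ν⁻¹ * kineticDensity (jastrowC L φ) X := by
    have := kineticDensity_real_mul_const hd (Real.sqrt ν)⁻¹ X
    rw [inv_pow, Real.sq_sqrt hν.le] at this
    exact this
  have hpot : ((‖(hφ.trialState hL hbL hν).ψ X‖₊ : ℝ≥0∞)) ^ 2 =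
      ENNReal.ofReal ν⁻¹ * ENNReal.ofReal (jastrow L φ univ X ^ 2) := by
    show ((‖((jastrow L φ univ X * (Real.sqrt ν)⁻¹ : ℝ) : ℂ)‖₊ : ℝ≥0∞)) ^ 2 = _
    rw [ennnorm_real_sq, mul_pow, inv_pow, Real.sq_sqrt hν.le, mul_comm,
      ENNReal.ofReal_mul (inv_nonneg.mpr hν.le)]
  rw [hkin, hpot, mul_add, mul_left_comm]

end TrialState

/-! ### Counting the pair and three-body terms -/

section Counting

open Finset

variable {N : ℕ}

/-- `∑_k ∑_{l ≠ k} c = N(N-1) c`. [folklore] -/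
theorem sum_erase_const (c : ℝ≥0∞) :
    ∑ k : Fin N, ∑ _l ∈ univ.erase k, c = ((N : ℝ≥0∞) * ((N - 1 : ℕ) : ℝ≥0∞)) * c := by
  simp only [sum_const, card_erase_of_mem (mem_univ _), card_univ, Fintype.card_fin, nsmul_eq_mul]
  ring

/-- `∑_k ∑_{i ≠ k} ∑_{j ≠ k, i} c = N(N-1)(N-2) c`. [folklore] -/
theorem sum_erase_erase_const (c : ℝ≥0∞) :
    ∑ k : Fin N, ∑ i ∈ univ.erase k, ∑ _j ∈ (univ.erase k).erase i, c =
      ((N : ℝ≥0∞) * ((N - 1 : ℕ) : ℝ≥0∞) * ((N - 2 : ℕ) : ℝ≥0∞)) * c := by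
  have h : ∀ k : Fin N, ∑ i ∈ univ.erase k, ∑ _j ∈ (univ.erase k).erase i, c =
      ∑ _i ∈ univ.erase k, ((N - 2 : ℕ) : ℝ≥0∞) * c := by
    intro k
    refine sum_congr rfl fun i hi => ?_
    have h2 : N - 1 - 1 = N - 2 := by omega
    rw [sum_const, card_erase_of_mem hi, card_erase_of_mem (mem_univ k), card_univ, Fintype.card_fin,
      nsmul_eq_mul, h2]
  simp_rw [h]
  rw [sum_erase_const]
  ring

/-- `2 ∑_i #{j : i < j} = N(N-1)` (the number of pairs). [folklore] -/
theorem two_mul_sum_card_filter_lt :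
    2 * ∑ i : Fin N, (univ.filter (i < ·)).card = N * (N - 1) := by
  have h : ∀ i : Fin N, (univ.filter (i < ·)).card = N - 1 - (i : ℕ) := fun i => by
    rw [Finset.filter_lt_eq_Ioi, Fin.card_Ioi]
  simp_rw [h]
  have hrefl := Finset.sum_range_reflect (fun i => i) N
  rw [Fin.sum_univ_eq_sum_range (fun i => N - 1 - i) N, hrefl, mul_comm, Finset.sum_range_id_mul_two]

/-- `∑_{i<j} c = N(N-1)/2 · c`. [folklore] -/
theorem sum_filter_lt_const (hN : 1 ≤ N) (c : ℝ≥0∞) :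
    ∑ i : Fin N, ∑ _j ∈ univ.filter (i < ·), c = ENNReal.ofReal ((N : ℝ) * ((N : ℝ) - 1) / 2) * c := by
  simp only [sum_const, nsmul_eq_mul, ← sum_mul]
  congr 1
  have h := two_mul_sum_card_filter_lt (N := N)
  have h' : (2 : ℝ) * ((∑ i : Fin N, (univ.filter (i < ·)).card : ℕ) : ℝ) = N * ((N : ℝ) - 1) := by
    have := congrArg (fun n : ℕ => (n : ℝ)) h
    simp only [Nat.cast_mul, Nat.cast_ofNat, Nat.cast_sub hN, Nat.cast_one] at this
    exact this
  rw [← Nat.cast_sum, ← ENNReal.ofReal_natCast]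
  congr 1
  linarith

end Counting

/-! ### Proof of the product-state bound `LSSY2005_jastrowBound` -/

section Final

open Finset

/-- `(‖r‖₊)² = r²` in `ℝ≥0∞` for real `r`. [folklore] -/
theorem ennnorm_sq_real (r : ℝ) : ((‖r‖₊ : ℝ≥0∞)) ^ 2 = ENNReal.ofReal (r ^ 2) := by
  rw [← enorm_eq_nnnorm, Real.enorm_eq_ofReal_abs, ← ENNReal.ofReal_pow (abs_nonneg _), sq_abs]

/-- `E₁ = 2𝓔[φ] = 2∫|∇φ|² + ∫ vφ²`. [cite: LSSY2005, Thm. 2.2, proof, (2.27)–(2.28)] -/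
theorem profileEnergy_eq {v : ℝ → ℝ≥0∞} {φ : Space → ℝ} (hφ : ContDiff ℝ 1 φ) :
    profileEnergy v φ = 2 * (∫⁻ x, gradSq φ x) + ∫⁻ x, v ‖x‖ * ENNReal.ofReal (φ x ^ 2) := by
  unfold profileEnergy scatteringFunctional
  have h1 : ∀ x : Space, gradSq φ x + 2⁻¹ * v ‖x‖ * ((‖φ x‖₊ : ℝ≥0∞)) ^ 2 =
      gradSq φ x + 2⁻¹ * (v ‖x‖ * ENNReal.ofReal (φ x ^ 2)) := fun x => by
    rw [ennnorm_sq_real, mul_assoc]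
  simp_rw [h1]
  rw [lintegral_add_left (measurable_gradSq hφ), lintegral_const_mul' _ _ (by simp), mul_add,
    ← mul_assoc, ENNReal.mul_inv_cancel two_ne_zero ENNReal.ofNat_ne_top, one_mul]

/-- The kinetic energy density is measurable (for any `Ψ`). [folklore] -/
theorem kineticDensity_measurable {N : ℕ} (Ψ : Config N → ℂ) : Measurable (kineticDensity Ψ) :=
  Finset.measurable_sum _ fun i _ => measurable_gradSqAt i Ψ

/-- **LSSY 2005, proof of Thm. 2.2, step 2 (the product trial state), proved.**
[cite: LSSY2005, Thm. 2.2, proof, (2.19)–(2.31); Dyson1957] -/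
theorem LSSY2005_jastrowBound_holds : LSSY2005_jastrowBound := by
  intro v hv N L b hN hL hb hbL φ hφ E I K hE0 hI0 hK0 hE hI hK hNI
  classical
  -- real parameters
  have hN2 : (2 : ℝ) ≤ N := by exact_mod_cast hN
  have hN1 : 1 ≤ N := by omega
  have hL3 : 0 < L ^ 3 := by positivity
  have hden : 0 < L ^ 3 - ((N : ℝ) - 1) * I := by linarith
  set D : ℝ := L ^ 3 / (L ^ 3 - ((N : ℝ) - 1) * I) with hD
  have hD0 : 0 < D := div_pos hL3 hden
  set ν := jastrowNormR L φ (univ : Finset (Fin N)) with hν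
  have hν0 : 0 < ν := hφ.jastrowNormR_pos hL hbL hI0 hI hNI univ
  -- norms of the states with one or two particles eliminated
  have hn1 : ∀ k : Fin N, jastrowNormSq L φ (univ.erase k) ≤ ENNReal.ofReal (D * ν) := by
    intro k
    rw [← hφ.ofReal_jastrowNormR]
    exact ENNReal.ofReal_le_ofReal (hφ.jastrowNormR_erase_le' hL hbL hI0 hI hNI univ (mem_univ k))
  have hn2 : ∀ i j : Fin N, j ≠ i →
      jastrowNormSq L φ ((univ.erase i).erase j) ≤ ENNReal.ofReal (D ^ 2 * ν) := by
    intro i j hji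
    rw [← hφ.ofReal_jastrowNormR]
    refine ENNReal.ofReal_le_ofReal ?_
    have h1 := hφ.jastrowNormR_erase_le' hL hbL hI0 hI hNI (univ.erase i)
      (mem_erase.mpr ⟨hji, mem_univ j⟩)
    have h2 := hφ.jastrowNormR_erase_le' hL hbL hI0 hI hNI univ (mem_univ i)
    calc jastrowNormR L φ ((univ.erase i).erase j) ≤ D * jastrowNormR L φ (univ.erase i) := h1
      _ ≤ D * (D * ν) := mul_le_mul_of_nonneg_left h2 hD0.le
      _ = D ^ 2 * ν := by ring
  -- the one-body integrals of the profile, as real numbers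
  set G := ∫⁻ x, gradSq φ x with hG
  set P := ∫⁻ x, v ‖x‖ * ENNReal.ofReal (φ x ^ 2) with hP
  have hGP : 2 * G + P = profileEnergy v φ := (profileEnergy_eq hφ.contDiff).symm
  have hGP' : 2 * G + P ≤ ENNReal.ofReal E := hGP ▸ hE
  have hGtop : G ≠ ⊤ := by
    refine ne_top_of_le_ne_top ENNReal.ofReal_ne_top ((le_trans ?_ le_self_add).trans hGP')
    rw [two_mul]; exact le_self_add
  have hPtop : P ≠ ⊤ := ne_top_of_le_ne_top ENNReal.ofReal_ne_top (le_add_self.trans hGP')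
  have hKtop : profileK φ ≠ ⊤ := ne_top_of_le_ne_top ENNReal.ofReal_ne_top hK
  set g := G.toReal with hg
  set p := P.toReal with hp
  set κ := (profileK φ).toReal with hκ
  have hg0 : 0 ≤ g := ENNReal.toReal_nonneg
  have hp0 : 0 ≤ p := ENNReal.toReal_nonneg
  have hκ0 : 0 ≤ κ := ENNReal.toReal_nonneg
  have hGe : G = ENNReal.ofReal g := (ENNReal.ofReal_toReal hGtop).symm
  have hPe : P = ENNReal.ofReal p := (ENNReal.ofReal_toReal hPtop).symm
  have hKe : profileK φ = ENNReal.ofReal κ := (ENNReal.ofReal_toReal hKtop).symm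
  have hgp : 2 * g + p ≤ E := by
    have h2G : (2 * G) ≠ ⊤ := ENNReal.mul_ne_top ENNReal.ofNat_ne_top hGtop
    have := ENNReal.toReal_le_of_le_ofReal hE0 hGP'
    rwa [ENNReal.toReal_add h2G hPtop, ENNReal.toReal_mul, ENNReal.toReal_ofNat] at this
  have hκK : κ ≤ K := ENNReal.toReal_le_of_le_ofReal hK0 hK
  have hL3e : (ENNReal.ofReal L ^ 3)⁻¹ = ENNReal.ofReal ((L ^ 3)⁻¹) := by
    rw [← ENNReal.ofReal_pow hL.le, ENNReal.ofReal_inv_of_pos hL3]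
  have hL3i : 0 ≤ (L ^ 3)⁻¹ := inv_nonneg.mpr hL3.le
  -- Step 1: the three families of terms, each bounded by a real number
  have hT1 : ∀ k : Fin N, ∀ l ∈ univ.erase k,
      (ENNReal.ofReal L ^ 3)⁻¹ * G * jastrowNormSq L φ (univ.erase k) ≤
        ENNReal.ofReal ((L ^ 3)⁻¹ * g * (D * ν)) := by
    intro k l _
    rw [hL3e, hGe, ← ENNReal.ofReal_mul hL3i, ENNReal.ofReal_mul (mul_nonneg hL3i hg0)]
    exact mul_le_mul' le_rfl (hn1 k)
  have hT2 : ∀ k : Fin N, ∀ i ∈ univ.erase k, ∀ j ∈ (univ.erase k).erase i,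
      (ENNReal.ofReal L ^ 3)⁻¹ * profileK φ * ((ENNReal.ofReal L ^ 3)⁻¹ * profileK φ *
          jastrowNormSq L φ ((univ.erase i).erase j)) ≤
        ENNReal.ofReal ((L ^ 3)⁻¹ * κ * ((L ^ 3)⁻¹ * κ * (D ^ 2 * ν))) := by
    intro k i _ j hj
    have hji : j ≠ i := ne_of_mem_erase hj
    rw [hL3e, hKe, ← ENNReal.ofReal_mul hL3i,
      ENNReal.ofReal_mul (mul_nonneg hL3i hκ0), ENNReal.ofReal_mul (mul_nonneg hL3i hκ0)]
    exact mul_le_mul' le_rfl (mul_le_mul' le_rfl (hn2 i j hji))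
  have hT3 : ∀ i : Fin N, ∀ j ∈ univ.filter (i < ·),
      (ENNReal.ofReal L ^ 3)⁻¹ * P * jastrowNormSq L φ (univ.erase i) ≤
        ENNReal.ofReal ((L ^ 3)⁻¹ * p * (D * ν)) := by
    intro i j _
    rw [hL3e, hPe, ← ENNReal.ofReal_mul hL3i, ENNReal.ofReal_mul (mul_nonneg hL3i hp0)]
    exact mul_le_mul' le_rfl (hn1 i)
  -- Step 2: sum them
  have hr1 : 0 ≤ (L ^ 3)⁻¹ * g * (D * ν) := by positivity
  have hr2 : 0 ≤ (L ^ 3)⁻¹ * κ * ((L ^ 3)⁻¹ * κ * (D ^ 2 * ν)) := by positivity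
  have hr3 : 0 ≤ (L ^ 3)⁻¹ * p * (D * ν) := by positivity
  have hNNr : 0 ≤ (N : ℝ) * ((N : ℝ) - 1) := mul_nonneg (Nat.cast_nonneg _) (by linarith)
  have hNNNr : 0 ≤ (N : ℝ) * ((N : ℝ) - 1) * ((N : ℝ) - 2) := mul_nonneg hNNr (by linarith)
  have hNN1 : ((N : ℝ≥0∞) * ((N - 1 : ℕ) : ℝ≥0∞)) = ENNReal.ofReal ((N : ℝ) * ((N : ℝ) - 1)) := by
    rw [← ENNReal.ofReal_natCast, ← ENNReal.ofReal_natCast, Nat.cast_sub hN1, Nat.cast_one,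
      ← ENNReal.ofReal_mul (Nat.cast_nonneg _)]
  have hNN2 : ((N : ℝ≥0∞) * ((N - 1 : ℕ) : ℝ≥0∞) * ((N - 2 : ℕ) : ℝ≥0∞)) =
      ENNReal.ofReal ((N : ℝ) * ((N : ℝ) - 1) * ((N : ℝ) - 2)) := by
    rw [hNN1, ← ENNReal.ofReal_natCast, Nat.cast_sub hN, Nat.cast_ofNat,
      ← ENNReal.ofReal_mul hNNr]
  have hkin : ∫⁻ X in cellN N L, kineticDensity (jastrowC L φ) X ≤
      ENNReal.ofReal ((N : ℝ) * ((N : ℝ) - 1) * ((L ^ 3)⁻¹ * g * (D * ν)) +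
        (N : ℝ) * ((N : ℝ) - 1) * ((N : ℝ) - 2) *
          ((L ^ 3)⁻¹ * κ * ((L ^ 3)⁻¹ * κ * (D ^ 2 * ν)))) := by
    refine (hφ.lintegral_kinetic_le hL hbL).trans ?_
    rw [ENNReal.ofReal_add (mul_nonneg hNNr hr1) (mul_nonneg hNNNr hr2)]
    refine add_le_add ?_ ?_
    · calc _ ≤ ∑ k : Fin N, ∑ _l ∈ univ.erase k, ENNReal.ofReal ((L ^ 3)⁻¹ * g * (D * ν)) :=
            sum_le_sum fun k _ => sum_le_sum fun l hl => hT1 k l hl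
        _ = _ := by rw [sum_erase_const, hNN1, ← ENNReal.ofReal_mul hNNr]
    · calc _ ≤ ∑ k : Fin N, ∑ i ∈ univ.erase k, ∑ _j ∈ (univ.erase k).erase i,
            ENNReal.ofReal ((L ^ 3)⁻¹ * κ * ((L ^ 3)⁻¹ * κ * (D ^ 2 * ν))) :=
            sum_le_sum fun k _ => sum_le_sum fun i hi => sum_le_sum fun j hj => hT2 k i hi j hj
        _ = _ := by rw [sum_erase_erase_const, hNN2, ← ENNReal.ofReal_mul hNNNr]
  have hpot : ∫⁻ X in cellN N L, periodicInteraction v L X * ENNReal.ofReal (jastrow L φ univ X ^ 2) ≤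
      ENNReal.ofReal ((N : ℝ) * ((N : ℝ) - 1) / 2 * ((L ^ 3)⁻¹ * p * (D * ν))) := by
    refine (hφ.lintegral_potential_le hL hbL hv).trans ?_
    calc _ ≤ ∑ i : Fin N, ∑ _j ∈ univ.filter (i < ·), ENNReal.ofReal ((L ^ 3)⁻¹ * p * (D * ν)) :=
          sum_le_sum fun i _ => sum_le_sum fun j hj => hT3 i j hj
      _ = _ := by rw [sum_filter_lt_const hN1, ← ENNReal.ofReal_mul (div_nonneg hNNr zero_le_two)]
  -- Step 3: the energy of the normalised trial state
  set A : ℝ := (N : ℝ) * ((N : ℝ) - 1) * ((L ^ 3)⁻¹ * g * (D * ν)) +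
      (N : ℝ) * ((N : ℝ) - 1) * ((N : ℝ) - 2) * ((L ^ 3)⁻¹ * κ * ((L ^ 3)⁻¹ * κ * (D ^ 2 * ν))) +
      (N : ℝ) * ((N : ℝ) - 1) / 2 * ((L ^ 3)⁻¹ * p * (D * ν)) with hA
  have hA1 : 0 ≤ (N : ℝ) * ((N : ℝ) - 1) * ((L ^ 3)⁻¹ * g * (D * ν)) +
      (N : ℝ) * ((N : ℝ) - 1) * ((N : ℝ) - 2) * ((L ^ 3)⁻¹ * κ * ((L ^ 3)⁻¹ * κ * (D ^ 2 * ν))) :=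
    add_nonneg (mul_nonneg hNNr hr1) (mul_nonneg hNNNr hr2)
  have hA2 : 0 ≤ (N : ℝ) * ((N : ℝ) - 1) / 2 * ((L ^ 3)⁻¹ * p * (D * ν)) :=
    mul_nonneg (div_nonneg hNNr zero_le_two) hr3
  set Ψt := hφ.trialState hL hbL hν0 with hΨt
  have htot : periodicEnergy v Ψt ≤ ENNReal.ofReal (ν⁻¹ * A) := by
    rw [hΨt, hφ.periodicEnergy_trialState hL hbL hν0 v,
      ENNReal.ofReal_mul (inv_nonneg.mpr hν0.le)]
    refine mul_le_mul' le_rfl ?_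
    rw [lintegral_add_left (kineticDensity_measurable _), hA, ENNReal.ofReal_add hA1 hA2]
    exact add_le_add hkin hpot
  -- Step 4: the algebra `ν⁻¹ A ≤ N(N-1)/2 · E/(L³-(N-1)I) + N(N-1)(N-2) K²/(L³-(N-1)I)²`
  have hB : ν⁻¹ * A = (N : ℝ) * ((N : ℝ) - 1) / 2 * (2 * g + p) / (L ^ 3 - ((N : ℝ) - 1) * I) +
      (N : ℝ) * ((N : ℝ) - 1) * ((N : ℝ) - 2) * κ ^ 2 / (L ^ 3 - ((N : ℝ) - 1) * I) ^ 2 := by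
    rw [hA, hD]
    field_simp
    ring
  have hNN : 0 ≤ (N : ℝ) * ((N : ℝ) - 1) := by nlinarith
  have hfin : ν⁻¹ * A ≤ (N : ℝ) * ((N : ℝ) - 1) / 2 * E / (L ^ 3 - ((N : ℝ) - 1) * I) +
      (N : ℝ) * ((N : ℝ) - 1) * ((N : ℝ) - 2) * K ^ 2 / (L ^ 3 - ((N : ℝ) - 1) * I) ^ 2 := by
    rw [hB]
    refine add_le_add ?_ ?_
    · refine div_le_div_of_nonneg_right ?_ hden.le
      exact mul_le_mul_of_nonneg_left hgp (by positivity)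
    · refine div_le_div_of_nonneg_right ?_ (by positivity)
      exact mul_le_mul_of_nonneg_left (pow_le_pow_left₀ hκ0 hκK 2) (by nlinarith)
  exact (periodicGroundStateEnergy_le v Ψt).trans (htot.trans (ENNReal.ofReal_le_ofReal hfin))

end Final

end Literature.MathematicalPhysics.QuantumManyBody.BoseGas

end
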